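import Literature.Barriers.CriticalPhenomena.PlaquetteWalkHoleRootStructuralKill
import HarnessLib

/-!
# Barrier catalogue (SAWScalingLimit): the PREFIX-LOOP SEPARATION LEMMA at the far cell of a hole root — the east
pair of the corner-kill table for EVERY wound walk, with no directness hypothesis

Leaf of `PlaquetteWalkHoleRootStructuralKill` (the STRUCTURAL honeycomb kills at the far cell `farW w = (w.1 − 2, w.2)`
of a hole root in the `W`-normalisation: root `a = w.side W`, hole `holeFaceW w = (w.1 − 1, w.2) ∉ D`). Its §10/§11
settle the EAST pair of the venture lane's corner-kill table (`K_S1 = (w.1 + 1, w.2 − 2)` kills the under route at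
the dual point, `K_N2 = (w.1 + 1, w.2 + 2)` the over route at the honeycomb point) for every wound walk whose first arc
does not leave the root plaquette `w` northwards (resp. southwards), and name the one configuration left open: a wound
UNDER-walk whose first arc leaves `w` through `N`, its excursion avoiding `w` — «excluded on paper by a Jordan
separation for the prefix loop, not typed». This file types that separation argument, in a form that needs neither
the Jordan curve theorem nor any case analysis of the first arc, and closes the east pair.

## The separation lemma (§1–§4)

For a class-`B2a` UNDER-walk `ω` at the far cell (first side `S`) the PREFIX — the arcs `0, …, F − 1` before the
first hit `F = firstHitG`, drawn in the mesh-`4` right-angle drawing of `YangBaxterSAWBoundaryWinding` — runs from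
the inner point of `w` next to the root to the inner point below the far cell's `S` side. Close it to a polygon
`C` (`ΩG.pCpt`, `ΩG.pClist`, `ΩG.pCedge`): after the prefix, the half crossing-stub up to the midpoint of the far
cell's `S` side, the segment `fSeg` inside the far cell to the midpoint of its `E` side (the hole's `W` side), and the
closing segment `hSeg` straight through the hole and through the MIDPOINT OF THE ROOT back to the first vertex.
`C` need not be simple; only its winding number `ΩG.windC` (the tree's `wind` of `Literature/Topology/PlaneTopology`)
is used:

* §2 ★ `ΩG.pJ_disjoint_pC` — the excursion polygon `J` of `ω` (`ΩG.pJ`, `YangBaxterSAWExcursionJordan`) MISSES `C`: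
  both are drawings of arcs and crossed mid-edges of ONE self-avoiding walk with disjoint index ranges (the mesh-`4`
  incidence lemmas `eq_of_mem_crossSeg`, `eq_side_of_mem_crossSeg_arcSeg`, `eq_face_of_mem_arcSeg`,
  `straight_of_mem_arcSeg_arcSeg` of that file, `YBWalk.nth_inj`, `YBWalk.not_straight_of_two_arcs`, and no prefix arc in
  the far cell); inside the far cell `J` is the chord between the `W` and `N` inner points plus the two stubs (the exit
  and return sides of an under-walk are `W` and `N`: `ΩG.z1_eq_W_or_N`, `ΩG.fst_eq_W_or_N`), off `fSeg`; and `J` never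
  enters the hole nor crosses the root (`ΩG.exit_ne_root`), so it misses `hSeg`.
* §3 `ΩG.windC_eq_of_segment` (transport along a `C`-free segment, `wind_affine_sub_eq_of_segment`),
  `ΩG.windC_pJ_edge` (hence `C` has ONE winding number along all of `J`), ★ `ΩG.windC_jump` — the winding numbers of
  `C` about the two corners of the root edge differ by one: the closing edge crosses the root edge transversally at
  the root's midpoint and no other edge of `C` meets the closed root edge (`wind_sub_wind_of_straight_cross` of
  `WindingNumberCrossing`, run exactly as in `ΩG.wind_jump` of the excursion file).
* §4 ★★★ `ΩG.exists_prefix_nth_eq_root_S` — **THE PREFIX-LOOP SEPARATION LEMMA**: if the excursion of an under-walk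
  crosses the bottom side of the cell `rootE w = (w.1 + 1, w.2)` east of the root plaquette (the top side of the eastern
  pocket), then the PREFIX crosses the bottom side of the root plaquette (`nth i = w.side S`, `1 ≤ i < F`). For `J`
  passes through the midpoint of the far cell's top side (one of exit/return is `N`) and through the midpoint of that
  eastern bottom side; the first is joined to the UPPER corner of the root edge along the top sides of the hole and of
  the far cell, the second to the LOWER corner along the bottom sides of `rootE w` and of `w` — lattice sides that `C`
  can only meet at the midpoint of a prefix mid-edge equal to that side (`ΩG.exists_nth_eq_of_mem_pCedge_sideSeg`):
  the hole's sides and the far cell's top side are never prefix mid-edges, `rootE.S` is the excursion's, so all four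
  pieces are `C`-free unless the prefix crosses `w.S`; one winding number along `J`, two different ones at the corners.

## The east pair closed (§5)

* ★★ `ΩG.kindsIn_rootS_eq_of_prefix_cross` — `K_S1` and the cell east of the eastern pocket absent: a prefix crossing
  of `w.S` plus an excursion crossing of the pocket's top side put a prefix arc with an `N` end and an excursion arc
  with an `E` end (the pocket's only other door is its `W` side — the parent's §10 pocket argument verbatim) into
  `rootS w = (w.1, w.2 − 1)`: `kindsIn (rootS w) = [corner, corner]`.
* ★★★ `ΩG.kindsIn_rootS_or_root_eq_of_AJ_ne_zero_under` — the dichotomy for a wound under-walk in the `K_S1` geometry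
  (hole, `K_S1`, `(w.1 + 2, w.2 − 1)` absent, bottom line of the root row uncrossable for `x ≥ w.1 + 2`): the odd eastern
  crossing of the parity law (`ΩG.exists_nth_eq_east_sides_of_AJ_ne_zero`, parent §10) is `w.S` — then `w` doubles
  (parent §11 (a)) — or the pocket's top side — then, by §4 and the previous item, `rootS w` doubles.
* ★★★★ `ΩG.not_W1FreeOff_farW_of_wound_under_east` / `ΩG.under_w1_killed_of_killSE` — **every WOUND class-`B2a`
  UNDER-walk at the far cell is `w₁`-marked off the far cell** (either orientation of the winding witness): the
  hypothesis `hS₁` of `PlaquetteWalkHoleRootKillForcedZeros` §4′ as a THEOREM, the parent's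
  `under_w1_killed_of_killSE_of_direct` / `…_of_not_north` with the directness hypothesis REMOVED.
* ★★★★ `ΩG.not_W2FreeOff_farW_of_wound_over_east` / `ΩG.over_w2_killed_of_killNE` — the row-mirror twin (`K_N2`,
  `(w.1 + 2, w.2 + 1)` absent, top line uncrossable): every wound OVER-walk is `w₂`-marked, by transport through the
  parent's reflection `ΩG.mirrorFar` (`mirrorFar_firstSideG`, `mirrorFar_wound`, `kindsIn_eq_coCorner_of_mirrorFar_corner`).
* ★★★★ `vertexFunctional_printed_farCellW_exists_eq_zero_Ioo_of_east_kills` — THE EASTERN KILL-FORCED ZERO with BOTH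
  universal kills THEOREMS: hole, `(w.1 + 1, w.2 ± 2)`, `(w.1 + 2, w.2 ± 1)` absent, the root row's two lines
  uncrossable for `x ≥ w.1 + 2`, one `w₂`-free wound under-walk and one `w₁`-free wound over-walk ⇒ an exact zero of
  the Yang–Baxter vertex functional in `(π/3, 2π/3)` (the parent's `…_of_killNE_of_killSE` without its «not south /
  not north» hypotheses; lane instance `6×5 ∖ {(3,2),(5,0),(5,4),(0,0)}`, zero in `[0.37208π, 0.37225π]`).

With the parent's §5/§7/§9 and its leaf `PlaquetteWalkHoleRootStructuralKillQuadrant` (the west pair `K_S2`/`K_N1` in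
every boundary position) all four rows of the venture lane's LAW L are now theorem schemas; the only data left in the
kill-forced zeros are the two existential free witnesses. A by-product of §4 (`ΩG.AJ_root_eq_zero_of_under_east`,
`ΩG.nth_one_ne_root_E_of_wound_under`): with the hole absent and the bottom line uncrossable east of `w.1 + 1`, no
wound under-walk has its first arc running EAST (its prefix cannot return through `w.S` next to the straight arc, so
the parity law's odd crossing would be `w.S`, forcing the first arc north) — the parent's §11 (b) is vacuous there,
consistently.

Scope: venture lane «pcv-sawmu», HOME `DESIGN-next-g24.md` §2–§3 (the paper case analysis this file replaces by one
winding-number argument), `FINDING-YB-KILL-FORCED-ZEROS.md` §12; seat b-step0 gen 25. Data side (parent docstring):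
`5×5 ∖ {(2,2),(4,0)}` 128/128, `6×6 ∖ {(3,2),(5,0)}` 64 192/64 192, `7×6`, `6×7` — 3 536 512 wound under-walks, all
with `rootS w` or `w` doubled (kit j264974/j264976/j264977). Not in print (the printed sources treat simply connected
domains rooted on the outer boundary, where no excursion winds around the root); elementary given the tree's
mesh-`4` drawing, its winding-number library and the parent files. The private plumbing of
`YangBaxterSAWExcursionJordan` / `YangBaxterSAWGeneralDomain` is read via `open private … from`.

References: A. Glazman, I. Manolescu, arXiv:1708.00395v3, §1 (Fig. 1, Fig. 2: «if θ = π/3, then w₂ = 0», the remark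
after eq. (1)) and Lemma 2.1 [GlazmanManolescu2019]; A. Glazman, Electron. Commun. Probab. 20 (2015) no. 86, Lemma 3.1,
proof pp. 6–7 (the classes of walks through a rhombus; «the arc … together with the segment of the rhombus forms a
closed curve») [Glazman2015WeightedSAW]; R. Courant, H. Robbins, *What is Mathematics?* (1941/1958), Ch. V Appendix
§2 (the Jordan curve theorem for polygons: the even–odd rule, the order of a point) [CourantRobbins1958]; L. V. Ahlfors,
*Complex Analysis*, 3rd ed. (1979), Ch. 4 §2.1 (the index of a point with respect to a closed curve; constancy on
components, jump across an arc) [AhlforsCA1979]; H. Duminil-Copin, S. Smirnov, Ann. of Math. 175 (2012), Lemma 1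
[DuminilCopinSmirnov2012].
-/

noncomputable section

open Set Function Complex
open Literature.Topology.PlaneTopology

namespace Literature.Probability.RandomPlanarGeometry.SAW.YangBaxter

open Real

open private fc_fh fc_ne rev_snd_nth from Literature.Probability.RandomPlanarGeometry.YangBaxterSAWGeneralDomain

open private mem_segment_toC cross_vert cross_slant arc_coords eq_of_mem_crossSeg eq_side_of_mem_crossSeg_arcSeg
  eq_face_of_mem_arcSeg straight_of_mem_arcSeg_arcSeg crossSeg_side_eq segment_subset_faceBox arcSeg_disjoint_faceBox
  crossSeg_faceBox sideSeg_coords_W sideSeg_coords_S sideSeg_coords_N eq_side_of_mem_crossSeg_sideSeg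
  not_mem_sideSeg_of_mem_arcSeg toC_cornerPt_not_mem_crossSeg toC_cornerPt_not_mem_arcSeg segSide_toC segSideZ_add
  from Literature.Probability.RandomPlanarGeometry.YangBaxterSAWExcursionJordan

open private jFace_zero jIn_zero jOut_zero jFace_pos jIn_pos jOut_pos len_eq jFace_ne_r side_jOut side_jIn
  segment_pJ_even segment_pJ_odd odd_index length_pJlist pJlist_getElem pJlist_getElem_succ pJlist_pos
  not_mem_range_of_forall jOut_side_eq_side_root lineMap_toC_add_sub_half toC_midPt_side_mem_sideSeg
  from Literature.Probability.RandomPlanarGeometry.YangBaxterSAWExcursionJordan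

/-! ## §0 Two segments through the hole: coordinates -/

section Segs

variable (w : Face)

/-- The segment inside the far cell from the midpoint of its `S` side to the midpoint of its `E` side (the hole's
`W` side). [cite: CourantRobbins1958, Ch. V Appendix §2 (The Jordan Curve Theorem for Polygons: the even–odd rule)] -/
def fSeg : Set ℂ := segment ℝ (toC (midPt ((farW w).side .S))) (toC (midPt ((farW w).side .E)))

/-- The segment through the hole from the midpoint of its `W` side to the inner point of the root plaquette next
to the root (it passes through the midpoint of the root). [cite: CourantRobbins1958, Ch. V Appendix §2 (The Jordan Curve Theorem for Polygons: the even–odd rule)] -/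
def hSeg : Set ℂ := segment ℝ (toC (midPt ((farW w).side .E))) (toC (innerPt w .W))

/-- Coordinates of the far cell's `S` midpoint. [folklore] -/
private theorem midPt_farW_S : midPt ((farW w).side .S) = (4 * w.1 - 6, 4 * w.2) := by
  obtain ⟨k, j⟩ := w; simp [farW, Face.side, midPt]; ring

/-- Coordinates of the far cell's `E` midpoint. [folklore] -/
private theorem midPt_farW_E : midPt ((farW w).side .E) = (4 * w.1 - 4, 4 * w.2 + 2) := by
  obtain ⟨k, j⟩ := w; simp [farW, Face.side, midPt]; ring

/-- Coordinates of the root plaquette's inner point next to the root. [folklore] -/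
private theorem innerPt_root_W : innerPt w .W = (4 * w.1 + 1, 4 * w.2 + 2) := by
  obtain ⟨k, j⟩ := w; simp [innerPt, Face.base, Side.inOff, Side.offset, Side.nIn]

/-- Coordinates on `fSeg`. [folklore] -/
private theorem fSeg_coords {p : ℂ} (hp : p ∈ fSeg w) :
    ∃ t : ℝ, 0 ≤ t ∧ t ≤ 1 ∧ p.re = 4 * w.1 - 6 + 2 * t ∧ p.im = 4 * w.2 + 2 * t := by
  rw [fSeg, midPt_farW_S, midPt_farW_E] at hp
  obtain ⟨t, h0, h1, hx, hy⟩ := mem_segment_toC hp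
  refine ⟨t, h0, h1, ?_, ?_⟩
  · rw [hx]; push_cast; ring
  · rw [hy]; push_cast; ring

/-- Coordinates on `hSeg`. [folklore] -/
private theorem hSeg_coords {p : ℂ} (hp : p ∈ hSeg w) :
    p.im = 4 * w.2 + 2 ∧ (4 * w.1 - 4 : ℝ) ≤ p.re ∧ p.re ≤ 4 * w.1 + 1 := by
  rw [hSeg, midPt_farW_E, innerPt_root_W] at hp
  obtain ⟨t, h0, h1, hx, hy⟩ := mem_segment_toC hp
  simp only [Int.cast_add, Int.cast_sub, Int.cast_mul, Int.cast_ofNat, Int.cast_one] at hx hy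
  refine ⟨by rw [hy]; ring, ?_, ?_⟩ <;> rw [hx] <;> nlinarith

end Segs

/-! ## §1 The prefix loop: vertices, edges, and the drawn pieces they are -/

namespace ΩG

variable {D : Set Face} {w : Face}

variable (ω : ΩG D (w.side .W) (farW w)) in
/-- The vertices of the PREFIX LOOP of a walk at the far cell with first side `S`: the inner points of the
prefix arcs `0, …, firstHitG − 1` (entry point, exit point, in order), then the midpoint of the far cell's `S`
side (the first hit) and the midpoint of its `E` side (the hole's `W` side); the closing edge runs through the hole
back to the first vertex, the root plaquette's inner point next to the root.
[cite: CourantRobbins1958, Ch. V Appendix §2 (The Jordan Curve Theorem for Polygons: the even–odd rule)] -/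
def pCpt (k : ℕ) : ℤ × ℤ :=
  if k < 2 * ω.2.firstHitG then (if k % 2 = 0 then ω.2.ptIn (k / 2) else ω.2.ptOut (k / 2))
  else if k = 2 * ω.2.firstHitG then midPt ((farW w).side .S) else midPt ((farW w).side .E)

variable (ω : ΩG D (w.side .W) (farW w)) in
/-- The number of vertices of the prefix loop. [folklore] -/
def pCN : ℕ := 2 * ω.2.firstHitG + 2

variable (ω : ΩG D (w.side .W) (farW w)) in
/-- The vertex list of the prefix loop, as complex points. [folklore] -/
def pClist : List ℂ := (List.range ω.pCN).map fun k => toC (ω.pCpt k)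

variable (ω : ΩG D (w.side .W) (farW w)) in
/-- The closed edge `k` of the prefix loop (cyclic indices). [folklore] -/
def pCedge (k : ℕ) : Set ℂ := segment ℝ (toC (ω.pCpt k)) (toC (ω.pCpt ((k + 1) % ω.pCN)))

variable {ω : ΩG D (w.side .W) (farW w)}

/-- Even prefix vertices are entry inner points. [folklore] -/
private theorem pCpt_even {i : ℕ} (hi : i < ω.2.firstHitG) : ω.pCpt (2 * i) = ω.2.ptIn i := by
  unfold pCpt
  rw [if_pos (by omega), if_pos (by omega)]
  congr 1; omega

/-- Odd prefix vertices are exit inner points. [folklore] -/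
private theorem pCpt_odd {i : ℕ} (hi : i < ω.2.firstHitG) : ω.pCpt (2 * i + 1) = ω.2.ptOut i := by
  unfold pCpt
  rw [if_pos (by omega), if_neg (by omega)]
  congr 1; omega

/-- The vertex after the prefix: the midpoint of the far cell's `S` side. [folklore] -/
private theorem pCpt_fS : ω.pCpt (2 * ω.2.firstHitG) = midPt ((farW w).side .S) := by
  unfold pCpt; rw [if_neg (by omega), if_pos rfl]

/-- The last vertex: the midpoint of the far cell's `E` side. [folklore] -/
private theorem pCpt_fE : ω.pCpt (2 * ω.2.firstHitG + 1) = midPt ((farW w).side .E) := by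
  unfold pCpt; rw [if_neg (by omega), if_neg (by omega)]

/-- The prefix loop has `2·firstHitG + 2` vertices. [folklore] -/
@[simp] private theorem length_pClist : ω.pClist.length = ω.pCN := by simp [pClist]

/-- The `k`-th vertex of the list. [folklore] -/
private theorem pClist_getElem {k : ℕ} (hk : k < ω.pClist.length) : ω.pClist[k] = toC (ω.pCpt k) := by
  simp [pClist]

/-- The vertex list is nonempty. [folklore] -/
private theorem pClist_pos : 0 < ω.pClist.length := by rw [length_pClist, pCN]; omega

/-- The cyclically next vertex. [folklore] -/
private theorem pClist_getElem_succ (k : ℕ) :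
    ω.pClist[(k + 1) % ω.pClist.length]'(Nat.mod_lt _ pClist_pos) = toC (ω.pCpt ((k + 1) % ω.pCN)) := by
  rw [pClist_getElem]; simp only [length_pClist]

/-- A point of the prefix loop lies on one of its closed edges. [folklore] -/
private theorem exists_mem_pCedge_of_mem_range {z : ℂ} (hz : z ∈ range (polygonLoop ω.pClist)) :
    ∃ k, k < ω.pCN ∧ z ∈ ω.pCedge k := by
  have hl : ω.pClist ≠ [] := List.ne_nil_of_length_pos pClist_pos
  rw [range_polygonLoop hl, mem_iUnion] at hz
  obtain ⟨k, hk⟩ := hz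
  have hk2 : (k : ℕ) < ω.pCN := by simpa using k.2
  rw [pClist_getElem, pClist_getElem_succ] at hk
  exact ⟨k, hk2, hk⟩

/-- A point off the closed edges of the prefix loop is off the loop. [folklore] -/
private theorem not_mem_range_pC {b : ℂ} (hb : ∀ k < ω.pCN, b ∉ ω.pCedge k) : b ∉ range (polygonLoop ω.pClist) := by
  intro h
  obtain ⟨k, hk, hz⟩ := exists_mem_pCedge_of_mem_range h
  exact hb k hk hz

/-! ### The edges as drawn pieces -/

/-- An even edge of the prefix loop is the arc segment of a prefix arc. [folklore] -/
private theorem pCedge_arc {i : ℕ} (hi : i < ω.2.firstHitG) :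
    ω.pCedge (2 * i) = arcSeg (ω.2.fc i) (ω.2.sIn i) (ω.2.sOut i) := by
  rw [pCedge, Nat.mod_eq_of_lt (by rw [pCN]; omega), pCpt_even hi, pCpt_odd hi, arcSeg, YBWalk.ptIn, YBWalk.ptOut]

/-- An odd edge of the prefix loop between two prefix arcs is the crossing segment of the mid-edge between them.
[folklore] -/
private theorem pCedge_cross (h : ω.IsB2a) {i : ℕ} (hi : i + 1 < ω.2.firstHitG) :
    ω.pCedge (2 * i + 1) = crossSeg (ω.2.nth (i + 1)) := by
  have hF := ω.fh_lt h
  rw [pCedge, Nat.mod_eq_of_lt (by rw [pCN]; omega), pCpt_odd (by omega),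
    show 2 * i + 1 + 1 = 2 * (i + 1) by ring, pCpt_even hi, YBWalk.ptIn, YBWalk.ptOut]
  obtain ⟨-, hout, -⟩ := ω.2.side_sIn_nth (i := i) (by omega)
  obtain ⟨hin, -, -⟩ := ω.2.side_sIn_nth (i := i + 1) (by omega)
  have hface : ω.2.fc i ≠ ω.2.fc (i + 1) := YBWalk.fc_succ_ne (by omega)
  rw [← hout, crossSeg_side_eq, innerPt_eq (ω.2.fc (i + 1)), hin, ← hout,
    nIn_eq_neg_of_side_eq (hout.trans hin.symm) hface, sub_eq_add_neg]

/-- The last odd edge of the prefix loop is the inner half of the crossing segment at the first hit. [folklore] -/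
private theorem pCedge_lastCross_subset (h : ω.IsB2a) (hS : ω.2.firstSideG = .S) :
    ω.pCedge (2 * ω.2.firstHitG - 1) ⊆ crossSeg (ω.2.nth ω.2.firstHitG) := by
  have hF := ω.fh_lt h
  have h1 := ω.one_le_firstHitG_far
  set F := ω.2.firstHitG with hFdef
  have e1 : ω.pCpt (2 * F - 1) = ω.2.ptOut (F - 1) := by
    rw [show 2 * F - 1 = 2 * (F - 1) + 1 by omega]; exact pCpt_odd (by omega)
  rw [pCedge, Nat.mod_eq_of_lt (by rw [pCN]; omega), show 2 * F - 1 + 1 = 2 * F by omega, e1, pCpt_fS,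
    YBWalk.ptOut]
  obtain ⟨-, hout, -⟩ := ω.2.side_sIn_nth (i := F - 1) (by omega)
  rw [show F - 1 + 1 = F by omega] at hout
  have hnth : ω.2.nth F = (farW w).side .S := by rw [hFdef, ω.2.nth_firstHitG, hS]
  rw [← hout, crossSeg_side_eq, innerPt_eq, hout, hnth]
  -- `[m + n, m] ⊆ [m + n, m - n]`
  refine (convex_segment _ _).segment_subset (left_mem_segment _ _ _) ?_
  rw [segment_eq_image_lineMap]
  refine ⟨1 / 2, ⟨by norm_num, by norm_num⟩, ?_⟩
  rw [AffineMap.lineMap_apply_module']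
  apply Complex.ext <;> simp [toC] <;> ring

/-- The edge inside the far cell. [folklore] -/
private theorem pCedge_fSeg : ω.pCedge (2 * ω.2.firstHitG) = fSeg w := by
  rw [pCedge, Nat.mod_eq_of_lt (by rw [pCN]; omega), pCpt_fS, pCpt_fE, fSeg]

/-- The closing edge through the hole. [folklore] -/
private theorem pCedge_hSeg (hh : holeFaceW w ∉ D) (h : ω.IsB2a) : ω.pCedge (2 * ω.2.firstHitG + 1) = hSeg w := by
  have hF := ω.fh_lt h
  have h1 := ω.one_le_firstHitG_far
  have e0 : ω.pCpt 0 = ω.2.ptIn 0 := by simpa using pCpt_even (ω := ω) (i := 0) (by omega)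
  rw [pCedge, show 2 * ω.2.firstHitG + 1 + 1 = ω.pCN by rw [pCN], Nat.mod_self, pCpt_fE, e0, YBWalk.ptIn,
    fc_zero_eq_root w hh ω.2 (by omega), ω.sIn_zero_eq_W hh (by omega), hSeg]

/-- The edges of the prefix loop other than the closing one: a prefix arc segment, the crossing segment of a
prefix mid-edge `nth i` (`1 ≤ i ≤ firstHitG`), or the segment in the far cell.
[cite: CourantRobbins1958, Ch. V Appendix §2 (The Jordan Curve Theorem for Polygons: the even–odd rule)] -/
theorem mem_pCedge_cases_lt (h : ω.IsB2a) (hS : ω.2.firstSideG = .S) {k : ℕ} (hk : k < 2 * ω.2.firstHitG + 1)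
    {p : ℂ} (hp : p ∈ ω.pCedge k) :
    (∃ i, i < ω.2.firstHitG ∧ p ∈ arcSeg (ω.2.fc i) (ω.2.sIn i) (ω.2.sOut i)) ∨
      (∃ i, 1 ≤ i ∧ i ≤ ω.2.firstHitG ∧ p ∈ crossSeg (ω.2.nth i)) ∨ p ∈ fSeg w := by
  have h1 := ω.one_le_firstHitG_far
  set F := ω.2.firstHitG with hFdef
  obtain ⟨i, rfl | rfl⟩ := Nat.even_or_odd' k
  · by_cases hi : i < F
    · left; exact ⟨i, hi, by rw [← pCedge_arc hi]; exact hp⟩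
    · have ei : i = F := by omega
      right; right
      rw [ei, pCedge_fSeg] at hp; exact hp
  · by_cases hi : i + 1 < F
    · right; left; exact ⟨i + 1, by omega, by omega, by rw [← pCedge_cross h hi]; exact hp⟩
    · have hi' : i + 1 = F := by omega
      right; left
      refine ⟨F, h1, le_rfl, pCedge_lastCross_subset h hS ?_⟩
      rw [show 2 * F - 1 = 2 * i + 1 by omega]; exact hp

/-- **What a point of the prefix loop is**: a point of a prefix arc segment, of the crossing segment of a prefix
mid-edge `nth i` (`1 ≤ i ≤ firstHitG`), of the segment in the far cell, or of the segment through the hole.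
[cite: CourantRobbins1958, Ch. V Appendix §2 (The Jordan Curve Theorem for Polygons: the even–odd rule)] -/
theorem mem_pCedge_cases (hh : holeFaceW w ∉ D) (h : ω.IsB2a) (hS : ω.2.firstSideG = .S) {k : ℕ} (hk : k < ω.pCN)
    {p : ℂ} (hp : p ∈ ω.pCedge k) :
    (∃ i, i < ω.2.firstHitG ∧ p ∈ arcSeg (ω.2.fc i) (ω.2.sIn i) (ω.2.sOut i)) ∨
      (∃ i, 1 ≤ i ∧ i ≤ ω.2.firstHitG ∧ p ∈ crossSeg (ω.2.nth i)) ∨ p ∈ fSeg w ∨ p ∈ hSeg w := by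
  rw [pCN] at hk
  by_cases hk' : k < 2 * ω.2.firstHitG + 1
  · rcases mem_pCedge_cases_lt h hS hk' hp with ha | hc | hf
    · exact Or.inl ha
    · exact Or.inr (Or.inl hc)
    · exact Or.inr (Or.inr (Or.inl hf))
  · have ek : k = 2 * ω.2.firstHitG + 1 := by omega
    rw [ek, pCedge_hSeg hh h] at hp
    exact Or.inr (Or.inr (Or.inr hp))

/-! ## §2 The excursion polygon misses the prefix loop -/

/-- The exit side of an under-walk at the far cell is `W` or `N`: not the first side `S`, and not the hole side
`E` (the exit side is a door). [cite: Glazman2015WeightedSAW, Lemma 3.1 (proof, pp. 6–7: the classes of walks through a rhombus)] -/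
theorem z1_eq_W_or_N (hh : holeFaceW w ∉ D) (hr : RootedFace D (w.side .W) (farW w)) (h : ω.IsB2a)
    (hS : ω.2.firstSideG = .S) : ω.z1 hr h = .W ∨ ω.z1 hr h = .N := by
  obtain ⟨h01, -, -⟩ := ω.firstSide_exit_return_distinct hr h
  obtain ⟨⟨-, hd⟩, -⟩ := ω.exit_return_doors hr h
  rw [hS] at h01
  have hE : ω.z1 hr h ≠ .E := by
    intro e; rw [e, farW_side_E_faces] at hd; exact hh hd
  revert h01 hE; cases ω.z1 hr h <;> decide

/-- The return side of an under-walk at the far cell is `W` or `N`. [cite: Glazman2015WeightedSAW, Lemma 3.1 (proof, pp. 6–7: the classes of walks through a rhombus)] -/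
theorem fst_eq_W_or_N (hh : holeFaceW w ∉ D) (hr : RootedFace D (w.side .W) (farW w)) (h : ω.IsB2a)
    (hS : ω.2.firstSideG = .S) : ω.1 = .W ∨ ω.1 = .N := by
  obtain ⟨-, h02, -⟩ := ω.firstSide_exit_return_distinct hr h
  obtain ⟨-, ⟨-, hd⟩⟩ := ω.exit_return_doors hr h
  rw [hS] at h02
  have hE : ω.1 ≠ .E := by
    intro e; rw [e, farW_side_E_faces] at hd; exact hh hd
  revert h02 hE; cases ω.1 <;> decide

/-- **What a point of the excursion polygon is**: a point of the crossing segment of an excursion mid-edge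
`nth (firstHitG + j + 1)` (`j < Mv`), of an excursion arc segment (arc `firstHitG + j`, `1 ≤ j < Mv`), or of the
chord of the far cell. [cite: Glazman2015WeightedSAW, Lemma 3.1 (proof, pp. 6–7: the classes of walks through a rhombus)] -/
theorem mem_pJedge_cases (hr : RootedFace D (w.side .W) (farW w)) (h : ω.IsB2a) {k : ℕ} (hk : k < 2 * ω.Mv)
    {p : ℂ} (hp : p ∈ segment ℝ (ω.pJ hr h k) (ω.pJ hr h (k + 1))) :
    (∃ j, j < ω.Mv ∧ p ∈ crossSeg (ω.2.nth (ω.2.firstHitG + j + 1))) ∨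
      (∃ j, 1 ≤ j ∧ j < ω.Mv ∧ p ∈ arcSeg (ω.2.fc (ω.2.firstHitG + j)) (ω.2.sIn (ω.2.firstHitG + j))
        (ω.2.sOut (ω.2.firstHitG + j))) ∨
      p ∈ arcSeg (farW w) ω.1 (ω.z1 hr h) := by
  have hM := ω.three_le_Mv hr h
  obtain ⟨j, rfl | rfl⟩ := Nat.even_or_odd' k
  · have hj : j < ω.Mv := by omega
    rw [segment_pJ_even h hj, side_jOut h hj] at hp
    exact Or.inl ⟨j, hj, hp⟩
  · obtain ⟨j', hj', e'⟩ := odd_index hr h hk (by omega)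
    rw [e', segment_pJ_odd h hj'] at hp
    by_cases hj0 : j' = 0
    · subst hj0; rw [jFace_zero, jIn_zero, jOut_zero] at hp; exact Or.inr (Or.inr hp)
    · rw [jFace_pos h hj0, jIn_pos h hj0, jOut_pos h hj0] at hp
      exact Or.inr (Or.inl ⟨j', Nat.pos_of_ne_zero hj0, hj', hp⟩)

/-- A crossing segment meeting the segment through the hole crosses the hole's `W` side or the root.
[cite: CourantRobbins1958, Ch. V Appendix §2 (the even–odd rule)] -/
theorem eq_of_mem_crossSeg_hSeg {e : MidEdge} {p : ℂ} (hp : p ∈ crossSeg e) (hq : p ∈ hSeg w) :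
    e = (farW w).side .E ∨ e = w.side .W := by
  obtain ⟨him, hre1, hre2⟩ := hSeg_coords w hq
  obtain ⟨a, b⟩ := w
  simp only at him hre1 hre2
  cases e with
  | vert k j =>
    obtain ⟨hy, hx⟩ := cross_vert hp
    rw [abs_le] at hx
    have hj : j = b := by
      have : (j : ℝ) = b := by linarith
      exact_mod_cast this
    have hk : k = a - 1 ∨ k = a := by
      have h1 : (k : ℝ) < a + 1 := by linarith
      have h2 : (a : ℝ) - 2 < k := by linarith
      have h1' : k < a + 1 := by exact_mod_cast h1
      have h2' : a - 2 < k := by exact_mod_cast h2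
      omega
    rcases hk with rfl | rfl
    · left; rw [hj]; simp [farW, Face.side]; ring
    · right; rw [hj]; simp [Face.side]
  | slant k j =>
    obtain ⟨hx, hy⟩ := cross_slant hp
    rw [abs_le] at hy
    rw [him] at hy
    exfalso
    have h1 : ((b - j : ℤ) : ℝ) < 0 := by push_cast; linarith
    have h2 : (-1 : ℝ) < ((b - j : ℤ) : ℝ) := by push_cast; linarith
    have h1' : b - j < 0 := by exact_mod_cast h1
    have h2' : -1 < b - j := by exact_mod_cast h2
    omega

/-- An arc segment meeting the segment through the hole lies in the hole or is an arc of the root plaquette with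
a `W` end. [cite: CourantRobbins1958, Ch. V Appendix §2 (the even–odd rule)] -/
theorem eq_of_mem_arcSeg_hSeg {F : Face} {s u : Side} {p : ℂ} (hp : p ∈ arcSeg F s u) (hq : p ∈ hSeg w) :
    F = holeFaceW w ∨ (F = w ∧ (s = .W ∨ u = .W)) := by
  obtain ⟨him, hre1, hre2⟩ := hSeg_coords w hq
  obtain ⟨hre, him', hW, -⟩ := arc_coords hp
  obtain ⟨a, b⟩ := w
  obtain ⟨a', b'⟩ := F
  simp only at him hre1 hre2 hre him' hW
  rw [abs_le] at hre him'
  have hb : b' = b := by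
    have h1 : (b' : ℝ) < b + 1 := by linarith
    have h2 : (b : ℝ) < b' + 1 := by linarith
    have h1' : b' < b + 1 := by exact_mod_cast h1
    have h2' : b < b' + 1 := by exact_mod_cast h2
    omega
  subst hb
  have ha : a' = a - 1 ∨ a' = a := by
    have h1 : (a' : ℝ) < a + 1 := by linarith
    have h2 : (a : ℝ) - 2 < a' := by linarith
    have h1' : a' < a + 1 := by exact_mod_cast h1
    have h2' : a - 2 < a' := by exact_mod_cast h2
    omega
  rcases ha with rfl | rfl
  · left; simp [holeFaceW]
  · right
    refine ⟨rfl, ?_⟩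
    by_contra hsu
    push Not at hsu
    have := hW hsu.1 hsu.2
    linarith

/-- The segment in the far cell lies in the closed far cell. [folklore] -/
private theorem fSeg_subset_faceBox : fSeg w ⊆ faceBox (farW w) := by
  have e1 : toC (midPt ((farW w).side .S)) = toC ((farW w).base + (2, 0)) := by rw [midPt_side]; rfl
  have e2 : toC (midPt ((farW w).side .E)) = toC ((farW w).base + (4, 2)) := by rw [midPt_side]; rfl
  rw [fSeg, e1, e2]
  exact segment_subset_faceBox (farW w) (by norm_num) (by norm_num)

/-- A crossing segment of a side of the far cell meeting the segment in the far cell is that of its `S` or `E`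
side. [cite: CourantRobbins1958, Ch. V Appendix §2 (the even–odd rule)] -/
theorem side_of_mem_crossSeg_fSeg {s : Side} {p : ℂ} (hp : p ∈ crossSeg ((farW w).side s)) (hq : p ∈ fSeg w) :
    s = .S ∨ s = .E := by
  obtain ⟨t, h0, h1, hx, hy⟩ := fSeg_coords w hq
  obtain ⟨a, b⟩ := w
  simp only at hx hy
  cases s
  · exfalso
    obtain ⟨-, hx'⟩ := cross_vert hp
    rw [abs_le, hx] at hx'
    simp only [farW] at hx'
    push_cast at hx'
    linarith [hx'.2]
  · right; rfl
  · left; rfl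
  · exfalso
    have hp' : p ∈ crossSeg (.slant (a - 2) (b + 1)) := hp
    obtain ⟨hx', hy'⟩ := cross_slant hp'
    rw [abs_le, hy] at hy'
    rw [hx] at hx'
    push_cast at hx' hy'
    have ht : t = 0 := by linarith
    rw [ht] at hy'
    linarith [hy'.1]

/-- The chord of an under-walk misses the segment in the far cell. [cite: Glazman2015WeightedSAW, Lemma 3.1 (proof, pp. 6–7: the classes of walks through a rhombus)] -/
theorem not_mem_fSeg_of_mem_chord {s u : Side} (hs : s = .W ∨ s = .N) (hu : u = .W ∨ u = .N) {p : ℂ}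
    (hp : p ∈ arcSeg (farW w) s u) (hq : p ∈ fSeg w) : False := by
  obtain ⟨t, h0, h1, hx, hy⟩ := fSeg_coords w hq
  obtain ⟨-, -, -, hE, hS, -⟩ := arc_coords hp
  obtain ⟨a, b⟩ := w
  simp only [farW] at hx hy hE hS
  have hsE : s ≠ .E := by rcases hs with rfl | rfl <;> decide
  have huE : u ≠ .E := by rcases hu with rfl | rfl <;> decide
  have hsS : s ≠ .S := by rcases hs with rfl | rfl <;> decide
  have huS : u ≠ .S := by rcases hu with rfl | rfl <;> decide
  have h1' := hE hsE huE
  have h2' := hS hsS huS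
  push_cast at h1' h2'
  rw [hx] at h1'
  rw [hy] at h2'
  linarith

/-- ★ **THE EXCURSION POLYGON MISSES THE PREFIX LOOP.** For a class-`B2a` under-walk at the far cell of a hole root
(hole absent), no closed edge of the excursion polygon `J` meets a closed edge of the prefix loop: the two are
drawings of disjoint sets of arcs and crossed mid-edges of ONE self-avoiding walk (plus, for the loop, a segment in
the far cell off the chord and the stubs, and a segment through the hole, which `J` never enters).
[cite: Glazman2015WeightedSAW, Lemma 3.1 (proof, pp. 6–7: the classes of walks through a rhombus)]
[cite: CourantRobbins1958, Ch. V Appendix §2 (The Jordan Curve Theorem for Polygons: the even–odd rule)] -/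
theorem pJ_disjoint_pC (hh : holeFaceW w ∉ D) (hr : RootedFace D (w.side .W) (farW w)) (h : ω.IsB2a)
    (hS : ω.2.firstSideG = .S) {k' : ℕ} (hk' : k' < 2 * ω.Mv) {k : ℕ} (hk : k < ω.pCN) {p : ℂ}
    (hp' : p ∈ segment ℝ (ω.pJ hr h k') (ω.pJ hr h (k' + 1))) (hp : p ∈ ω.pCedge k) : False := by
  have hM := ω.three_le_Mv hr h
  have hF := ω.fh_lt h
  have hlen : ω.2.arcs.length = ω.2.firstHitG + ω.Mv := len_eq h
  set F := ω.2.firstHitG with hFdef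
  set n := ω.2.arcs.length with hndef
  have hz1 := z1_eq_W_or_N hh hr h hS
  have hf1 := fst_eq_W_or_N hh hr h hS
  have hnthF : ω.2.nth F = (farW w).side .S := by rw [hFdef, ω.2.nth_firstHitG, hS]
  rcases mem_pCedge_cases hh h hS hk hp with ⟨i, hi, ha⟩ | ⟨i, hi1, hiF, hc⟩ | hf | hhs
  · -- a prefix arc segment
    rcases mem_pJedge_cases hr h hk' hp' with ⟨j, hj, hc'⟩ | ⟨j, hj1, hj, ha'⟩ | hch
    · -- against an excursion crossing segment: the crossed mid-edge would be a side of the prefix arc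
      obtain ⟨hin, hout, -⟩ := ω.2.side_sIn_nth (i := i) (by omega)
      rcases eq_side_of_mem_crossSeg_arcSeg hc' ha with e | e
      · rw [hin] at e; have := ω.2.nth_inj (by omega) (by omega) e; omega
      · rw [hout] at e; have := ω.2.nth_inj (by omega) (by omega) e; omega
    · -- against an excursion arc segment: same face, two arcs of one walk, both straight
      have hface := eq_face_of_mem_arcSeg ha ha'
      obtain ⟨hns, h12, h13, h14, h15⟩ := YBWalk.not_straight_of_two_arcs (γ := ω.2) (i := i) (i' := F + j)
        (by omega) (by omega) (by omega) hface.symm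
      have hsu := (ω.2.side_sIn_nth (i := i) (by omega)).2.2
      have hsu' := (ω.2.side_sIn_nth (i := F + j) (by omega)).2.2
      rw [← hface] at ha'
      exact hns (straight_of_mem_arcSeg_arcSeg ha ha' (Ne.symm h12) (Ne.symm h14) (Ne.symm h13) (Ne.symm h15)
        hsu hsu')
    · -- against the chord: the prefix arc would lie in the far cell
      have hface := eq_face_of_mem_arcSeg ha hch
      have hne := ω.2.arcFace_ne_of_lt_firstHitG (i := i) hi (by omega)
      rw [ω.2.arcFace_nth_eq_fc (by omega), hface] at hne
      exact hne rfl
  · -- the crossing segment of a prefix mid-edge `nth i`, `1 ≤ i ≤ F`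
    rcases mem_pJedge_cases hr h hk' hp' with ⟨j, hj, hc'⟩ | ⟨j, hj1, hj, ha'⟩ | hch
    · have e := eq_of_mem_crossSeg hc hc'
      have := ω.2.nth_inj (by omega) (by omega) e; omega
    · obtain ⟨hin, hout, -⟩ := ω.2.side_sIn_nth (i := F + j) (by omega)
      rcases eq_side_of_mem_crossSeg_arcSeg hc ha' with e | e
      · rw [hin] at e; have := ω.2.nth_inj (by omega) (by omega) e; omega
      · rw [hout] at e; have := ω.2.nth_inj (by omega) (by omega) e; omega
    · rcases eq_side_of_mem_crossSeg_arcSeg hc hch with e | e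
      · have e' : ω.2.nth i = ω.2.nth n := e.trans ω.2.nth_length.symm
        have := ω.2.nth_inj (by omega) le_rfl e'; omega
      · have e1 : ω.2.nth (F + 1) = (farW w).side (ω.z1 hr h) := (ω.2.exitSide_specG hr hF).1
        have := ω.2.nth_inj (by omega) (by omega) (e.trans e1.symm); omega
  · -- the segment in the far cell
    rcases mem_pJedge_cases hr h hk' hp' with ⟨j, hj, hc'⟩ | ⟨j, hj1, hj, ha'⟩ | hch
    · obtain ⟨s, hs⟩ := crossSeg_faceBox hc' (fSeg_subset_faceBox hf)
      rw [hs] at hc'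
      have hs' : (ω.jFace h j).side (ω.jOut hr h j) = (farW w).side s := by rw [side_jOut (hr := hr) h hj]; exact hs
      rcases jOut_side_eq_side_root h hj hs' with ⟨-, hsz⟩ | ⟨-, hsz⟩
      · rcases side_of_mem_crossSeg_fSeg hc' hf with e | e
        · obtain ⟨h01, -, -⟩ := ω.firstSide_exit_return_distinct hr h
          rw [hS, ← hsz, e] at h01; exact h01 rfl
        · rw [← hsz, e] at hz1; rcases hz1 with e' | e' <;> exact absurd e' (by decide)
      · rcases side_of_mem_crossSeg_fSeg hc' hf with e | e
        · obtain ⟨-, h02, -⟩ := ω.firstSide_exit_return_distinct hr h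
          rw [hS, ← hsz, e] at h02; exact h02 rfl
        · rw [← hsz, e] at hf1; rcases hf1 with e' | e' <;> exact absurd e' (by decide)
    · exact arcSeg_disjoint_faceBox (fc_ne ω hr h (by omega) (by omega)) ha' (fSeg_subset_faceBox hf)
    · exact not_mem_fSeg_of_mem_chord hf1 hz1 hch hf
  · -- the segment through the hole
    rcases mem_pJedge_cases hr h hk' hp' with ⟨j, hj, hc'⟩ | ⟨j, hj1, hj, ha'⟩ | hch
    · have hsj : (ω.jFace h j).side (ω.jOut hr h j) = ω.2.nth (F + j + 1) := side_jOut (hr := hr) h hj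
      rcases eq_of_mem_crossSeg_hSeg hc' hhs with e | e
      · rcases jOut_side_eq_side_root h hj (hsj.trans e) with ⟨-, hsz⟩ | ⟨-, hsz⟩
        · rw [← hsz] at hz1; rcases hz1 with e' | e' <;> exact absurd e' (by decide)
        · rw [← hsz] at hf1; rcases hf1 with e' | e' <;> exact absurd e' (by decide)
      · exact ω.exit_ne_root (hr := hr) h hj (hsj.trans e)
    · rcases eq_of_mem_arcSeg_hSeg ha' hhs with e | ⟨e, hsu⟩
      · have hD := (YBWalk.arcFace_arcAt (γ := ω.2) (i := F + j) (by omega)).2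
        rw [e] at hD; exact hh hD
      · obtain ⟨hin, hout, -⟩ := ω.2.side_sIn_nth (i := F + j) (by omega)
        rw [e] at hin hout
        rcases hsu with hs | hs
        · rw [hs] at hin
          have e0 : ω.2.nth (F + j) = ω.2.nth 0 := by rw [ω.2.nth_zero]; exact hin.symm
          have := ω.2.nth_inj (by omega) (by omega) e0; omega
        · rw [hs] at hout
          have e0 : ω.2.nth (F + j + 1) = ω.2.nth 0 := by rw [ω.2.nth_zero]; exact hout.symm
          have := ω.2.nth_inj (by omega) (by omega) e0; omega
    · rcases eq_of_mem_arcSeg_hSeg hch hhs with e | ⟨e, -⟩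
      · exact absurd (e ▸ hr.mem) hh
      · exact root_ne_farW w e.symm

/-! ## §3 The winding number of the prefix loop: transport along free segments, and the jump across the hole -/

variable (ω) in
/-- The winding number of the prefix loop about a point. [cite: AhlforsCA1979, Ch. 4 §2.1 (index of a point with respect to a closed curve)] -/
def windC (p : ℂ) : ℤ := wind (fun t ↦ polygonLoop ω.pClist t - p)

/-- **Transport**: a segment missing the closed edges of the prefix loop has the same winding number at its two
ends. [cite: AhlforsCA1979, Ch. 4 §2.1 (index of a point with respect to a closed curve)] -/
theorem windC_eq_of_segment {p q : ℂ} (hpq : ∀ z ∈ segment ℝ p q, ∀ k < ω.pCN, z ∉ ω.pCedge k) :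
    ω.windC p = ω.windC q := by
  have key := wind_affine_sub_eq_of_segment (L := polygonLoop ω.pClist) (a := 0) (b := 1) zero_le_one
    (continuous_polygonLoop _).continuousOn (by simpa using (periodic_polygonLoop ω.pClist 0).symm)
    (p := p) (q := q) (fun z hz hzL => not_mem_range_pC (hpq z hz) (image_subset_range _ _ hzL))
  simpa [windC] using key

/-- **The prefix loop has one winding number along the whole excursion polygon**: at every point of every closed
edge of `J` it equals the winding number at the first vertex of `J`.
[cite: AhlforsCA1979, Ch. 4 §2.1 (index of a point with respect to a closed curve)] -/
theorem windC_pJ_edge (hh : holeFaceW w ∉ D) (hr : RootedFace D (w.side .W) (farW w)) (h : ω.IsB2a)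
    (hS : ω.2.firstSideG = .S) {k : ℕ} (hk : k < 2 * ω.Mv) {z : ℂ}
    (hz : z ∈ segment ℝ (ω.pJ hr h k) (ω.pJ hr h (k + 1))) : ω.windC z = ω.windC (ω.pJ hr h 0) := by
  -- along each edge of `J`
  have edge : ∀ k < 2 * ω.Mv, ∀ z ∈ segment ℝ (ω.pJ hr h k) (ω.pJ hr h (k + 1)), ω.windC z = ω.windC (ω.pJ hr h k) := by
    intro k hk z hz
    refine (windC_eq_of_segment fun y hy k' hk' hy' => ?_).symm
    have hy2 : y ∈ segment ℝ (ω.pJ hr h k) (ω.pJ hr h (k + 1)) :=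
      (convex_segment _ _).segment_subset (left_mem_segment _ _ _) hz hy
    exact pJ_disjoint_pC hh hr h hS hk hk' hy2 hy'
  -- vertex to vertex
  have vert : ∀ k ≤ 2 * ω.Mv, ω.windC (ω.pJ hr h k) = ω.windC (ω.pJ hr h 0) := by
    intro k hk
    induction k with
    | zero => rfl
    | succ k ih =>
      rw [← ih (by omega)]
      exact edge k (by omega) _ (right_mem_segment _ _ _)
  rw [edge k hk z hz, vert k hk.le]

/-- The lower corner of the root edge. [folklore] -/
def cLo (w : Face) : ℂ := toC (w.base + Side.W.endA)

/-- The upper corner of the root edge. [folklore] -/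
def cHi (w : Face) : ℂ := toC (w.base + Side.W.endB)

/-- The root edge as a closed side. [folklore] -/
private theorem sideSeg_root : sideSeg w .W = segment ℝ (cLo w) (cHi w) := rfl

set_option maxHeartbeats 400000 in
/-- **The jump of the winding number of the prefix loop across the root edge**: the closing edge of the loop runs
straight through the hole and the midpoint of the root, from the left of the root edge to its right, and no other
edge of the loop meets the closed root edge; hence the winding numbers about the two corners of the root edge
differ by one. [cite: AhlforsCA1979, Ch. 4 §2.1 (index of a point with respect to a closed curve)]
[cite: CourantRobbins1958, Ch. V Appendix §2 (The Jordan Curve Theorem for Polygons: the even–odd rule)] -/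
theorem windC_jump (hh : holeFaceW w ∉ D) (h : ω.IsB2a) (hS : ω.2.firstSideG = .S) :
    ω.windC (cHi w) - ω.windC (cLo w) = 1 := by
  have hF := ω.fh_lt h
  have h1 := ω.one_le_firstHitG_far
  set l := ω.pClist with hl
  set N := ω.pCN with hN
  have hN2 : N = 2 * ω.2.firstHitG + 2 := rfl
  have hlen : l.length = N := length_pClist
  have hl0 : l ≠ [] := List.ne_nil_of_length_pos pClist_pos
  have hNpos : 0 < N := by omega
  have hNr : (0 : ℝ) < N := by exact_mod_cast hNpos
  set u : ℝ := (N - 1 : ℝ) / N with hu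
  have hN1 : ((N - 1 : ℕ) : ℝ) = (N : ℝ) - 1 := by rw [Nat.cast_sub (by omega), Nat.cast_one]
  have hlenR : ((l.length : ℕ) : ℝ) = N := by rw [hlen]
  have h1N : (1 : ℝ) ≤ N := by exact_mod_cast hNpos
  have hu0 : 0 ≤ u := div_nonneg (by linarith) hNr.le
  have hu1 : u < 1 := by rw [hu, div_lt_one hNr]; linarith
  set L : ℝ → ℂ := polygonLoop l with hL
  -- the ends of the closing edge
  have eA : l[N - 1]'(by rw [hlen]; omega) = toC (w.base + (-4, 2)) := by
    rw [pClist_getElem, show N - 1 = 2 * ω.2.firstHitG + 1 by omega, pCpt_fE, midPt_farW_E]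
    obtain ⟨a, b⟩ := w; simp [Face.base]; ring
  have e0 : ω.pCpt 0 = w.base + (1, 2) := by
    have e := pCpt_even (ω := ω) (i := 0) (by omega)
    rw [mul_zero] at e
    rw [e, YBWalk.ptIn, fc_zero_eq_root w hh ω.2 (by omega), ω.sIn_zero_eq_W hh (by omega)]; rfl
  have eB : l[0]'pClist_pos = toC (w.base + (1, 2)) := by rw [pClist_getElem, e0]
  have hLu : L u = toC (w.base + (-4, 2)) := by
    have e := polygonLoop_vertex (l := l) (k := N - 1) (by rw [hlen]; omega)
    rw [hlenR, hN1] at e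
    rw [hL, hu, e, eA]
  have hL1 : L 1 = toC (w.base + (1, 2)) := by
    have e := polygonLoop_vertex (l := l) (k := 0) pClist_pos
    rw [Nat.cast_zero, zero_div] at e
    have e1 : L 1 = L 0 := by rw [hL]; simpa using periodic_polygonLoop l 0
    rw [e1, hL, e, eB]
  -- the closing edge is straight
  have hmid : ∀ s ∈ Icc u 1, L s = AffineMap.lineMap (L u) (L 1) ((s - u) / (1 - u)) := by
    intro s hs
    have hθ : (s - u) / (1 - u) ∈ Icc (0 : ℝ) 1 :=
      ⟨div_nonneg (by linarith [hs.1]) (by linarith), (div_le_one (by linarith)).2 (by linarith [hs.2])⟩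
    have hsu : s = ((N - 1 : ℕ) + (s - u) / (1 - u)) / (l.length : ℝ) := by
      rw [hlenR, hN1]
      have h1u : 1 - u = 1 / N := by rw [hu]; field_simp; ring
      rw [h1u]; field_simp; rw [hu]; field_simp; ring
    have hl0' : 0 < l.length := by rw [hlen]; omega
    have eB' : l[(N - 1 + 1) % l.length]'(Nat.mod_lt _ hl0') = L 1 := by
      have e0' : l[(N - 1 + 1) % l.length]'(Nat.mod_lt _ hl0') = l[0]'hl0' :=
        getElem_congr_idx (by rw [hlen, show N - 1 + 1 = N by omega, Nat.mod_self])
      rw [e0', hL1, eB]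
    have e := polygonLoop_apply_div (l := l) (k := N - 1) (by rw [hlen]; omega) hθ
    rw [← hsu, eA, ← hLu, eB'] at e
    exact e
  -- off the closing edge, the loop runs through the other closed edges, which miss the root edge
  have hout : ∀ s ∈ Icc 0 u ∪ Icc 1 1, L s ∉ segment ℝ (cHi w) (cLo w) := by
    intro s hs hmem
    rw [segment_symm, ← sideSeg_root] at hmem
    -- `L s` lies on an edge `k < N - 1`
    have haux : ∃ k, k < N - 1 ∧ L s ∈ ω.pCedge k := by
      rcases hs with hs | hs
      · obtain ⟨k, hk, θ, hθ, hks, hv⟩ := polygonLoop_eq_of_floor hl0 s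
        have hfr : Int.fract s = s := Int.fract_eq_self.2 ⟨hs.1, lt_of_le_of_lt hs.2 hu1⟩
        rw [hfr, hlen] at hks
        rw [hlen] at hk
        have hkθ : (k : ℝ) + θ ≤ N - 1 := by
          have := hs.2; rw [hu, ← hks, div_le_div_iff_of_pos_right hNr] at this; exact this
        by_cases hkl : k < N - 1
        · refine ⟨k, hkl, ?_⟩
          rw [hL, hv, pClist_getElem, pClist_getElem_succ, pCedge, segment_eq_image_lineMap]
          exact ⟨θ, ⟨hθ.1, hθ.2.le⟩, rfl⟩
        · have hkN : k = N - 1 := by omega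
          have hθ0 : θ = 0 := by
            have : (k : ℝ) = N - 1 := by rw [hkN, hN1]
            linarith [hθ.1]
          refine ⟨N - 2, by omega, ?_⟩
          rw [hL, hv, hθ0, AffineMap.lineMap_apply_zero, pClist_getElem, hkN, pCedge,
            show N - 2 + 1 = N - 1 by omega, Nat.mod_eq_of_lt (by omega)]
          exact right_mem_segment _ _ _
      · have hs1 : s = 1 := le_antisymm hs.2 hs.1
        refine ⟨0, by omega, ?_⟩
        rw [hs1, hL1, ← e0, pCedge]
        exact left_mem_segment _ _ _
    obtain ⟨k, hk, hLs⟩ := haux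
    rcases mem_pCedge_cases_lt h hS (by omega) hLs with ⟨i, hi, ha⟩ | ⟨i, hi1, hiF, hc⟩ | hf
    · exact not_mem_sideSeg_of_mem_arcSeg ha hmem
    · obtain ⟨e, -⟩ := eq_side_of_mem_crossSeg_sideSeg hc hmem
      have e0 : ω.2.nth i = ω.2.nth 0 := by rw [ω.2.nth_zero]; exact e
      have := ω.2.nth_inj (by omega) (by omega) e0
      omega
    · obtain ⟨t, -, ht1, hx, -⟩ := fSeg_coords w hf
      obtain ⟨hx', -, -⟩ := sideSeg_coords_W hmem
      rw [hx'] at hx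
      linarith
  -- the side functional at the two ends of the closing edge, and the crossing point
  have hsides : ∀ Z : ℤ × ℤ, segSide (cHi w) (cLo w) (toC (w.base + Z)) = segSideZ Side.W.endB Side.W.endA Z := by
    intro Z; rw [cHi, cLo, segSide_toC, segSideZ_add]
  have hsides' : ∀ Z : ℤ × ℤ, segSide (toC (w.base + (-4, 2))) (toC (w.base + (1, 2))) (toC (w.base + Z)) =
      segSideZ (-4, 2) (1, 2) Z := by
    intro Z; rw [segSide_toC, segSideZ_add]
  have key := wind_sub_wind_of_straight_cross (L := L) (a := 0) (u := u) (u' := 1) (b := 1)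
    (ℓ := cHi w) (r := cLo w) hu0 hu1 le_rfl
    ((continuous_polygonLoop l).continuousOn) (by rw [hL]; simpa using (periodic_polygonLoop l 0).symm)
    hmid hout
    (by rw [hLu, hsides]; simp [segSideZ, Side.endA, Side.endB])
    (by rw [hL1, hsides]; simp [segSideZ, Side.endA, Side.endB])
    (by
      rw [hLu, hL1]
      refine exists_mem_segment_mem_openSegment (by rw [hsides]; simp [segSideZ, Side.endA, Side.endB])
        (by rw [hsides]; simp [segSideZ, Side.endA, Side.endB]) ?_ ?_
      · rw [cHi, hsides']; simp [segSideZ, Side.endB]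
      · rw [cLo, hsides']; simp [segSideZ, Side.endA])
  simpa [windC] using key

/-! ## §4 The separation lemma: an excursion through the top side of the eastern pocket forces the prefix through
the bottom side of the root plaquette -/

/-- The midpoint of a mid-edge lies on its crossing segment. [folklore] -/
private theorem toC_midPt_mem_crossSeg (e : MidEdge) : toC (midPt e) ∈ crossSeg e := by
  rw [crossSeg, segment_eq_image_lineMap]
  exact ⟨1 / 2, ⟨by norm_num, by norm_num⟩, lineMap_toC_add_sub_half _ _⟩

/-- The two segments through the hole miss every closed top side on the top line of the root row. [folklore] -/
private theorem not_mem_sideSeg_N_of_mem_fSeg_hSeg {c : Face} (hc : c.2 = w.2) {q : ℂ} (hq : q ∈ fSeg w ∨ q ∈ hSeg w) :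
    q ∉ sideSeg c .N := by
  intro hq'
  obtain ⟨hy, -, -⟩ := sideSeg_coords_N hq'
  rw [hc] at hy
  rcases hq with hq | hq
  · obtain ⟨t, -, ht1, -, hy'⟩ := fSeg_coords w hq
    rw [hy'] at hy; linarith
  · obtain ⟨hy', -, -⟩ := hSeg_coords w hq
    rw [hy'] at hy; linarith

/-- The two segments through the hole miss every closed bottom side on the bottom line of the root row from the
root plaquette eastwards. [folklore] -/
private theorem not_mem_sideSeg_S_of_mem_fSeg_hSeg {c : Face} (hc : c.2 = w.2) (hc1 : w.1 ≤ c.1) {q : ℂ}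
    (hq : q ∈ fSeg w ∨ q ∈ hSeg w) : q ∉ sideSeg c .S := by
  intro hq'
  obtain ⟨hy, hx, -⟩ := sideSeg_coords_S hq'
  rw [hc] at hy
  have hc1' : (w.1 : ℝ) ≤ c.1 := by exact_mod_cast hc1
  rcases hq with hq | hq
  · obtain ⟨t, ht0, -, hx', hy'⟩ := fSeg_coords w hq
    rw [hy'] at hy
    have ht : t = 0 := by linarith
    rw [hx', ht] at hx; linarith
  · obtain ⟨hy', -, -⟩ := hSeg_coords w hq
    rw [hy'] at hy; linarith

/-- **A point of the prefix loop on a closed lattice side off the two hole segments is the midpoint of a prefix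
mid-edge equal to that side.** [cite: CourantRobbins1958, Ch. V Appendix §2 (the even–odd rule)] -/
theorem exists_nth_eq_of_mem_pCedge_sideSeg (hh : holeFaceW w ∉ D) (h : ω.IsB2a) (hS : ω.2.firstSideG = .S)
    {k : ℕ} (hk : k < ω.pCN) {p : ℂ} (hp : p ∈ ω.pCedge k) {c : Face} {s : Side} (hq : p ∈ sideSeg c s)
    (hfh : ∀ q, q ∈ fSeg w ∨ q ∈ hSeg w → q ∉ sideSeg c s) :
    ∃ i, 1 ≤ i ∧ i ≤ ω.2.firstHitG ∧ ω.2.nth i = c.side s := by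
  rcases mem_pCedge_cases hh h hS hk hp with ⟨i, -, ha⟩ | ⟨i, hi1, hiF, hc⟩ | hf | hhs
  · exact absurd hq (not_mem_sideSeg_of_mem_arcSeg ha)
  · exact ⟨i, hi1, hiF, (eq_side_of_mem_crossSeg_sideSeg hc hq).1⟩
  · exact absurd hq (hfh p (Or.inl hf))
  · exact absurd hq (hfh p (Or.inr hhs))

/-- A prefix mid-edge is not a side of the far cell other than at the first hit. [cite: Glazman2015WeightedSAW, Lemma 3.1 (proof, pp. 6–7: the first crossing of ∂r)] -/
theorem firstHitG_le_of_nth_eq {i : ℕ} (hi : i ≤ ω.2.arcs.length) {s : Side} (e : ω.2.nth i = (farW w).side s) :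
    ω.2.firstHitG ≤ i := by
  have hmem : i ∈ ω.2.hitIdx (farW w) := (YBWalk.mem_hitIdx _ _).2 ⟨hi, s, e⟩
  unfold YBWalk.firstHitG
  exact Finset.min'_le _ _ hmem

/-- One of the exit and return sides of an under-walk is the far cell's `N` side: some slot of the excursion
polygon exits through it. [cite: Glazman2015WeightedSAW, Lemma 3.1 (proof, pp. 6–7: the classes of walks through a rhombus)] -/
theorem exists_jOut_eq_farW_N (hh : holeFaceW w ∉ D) (hr : RootedFace D (w.side .W) (farW w)) (h : ω.IsB2a)
    (hS : ω.2.firstSideG = .S) : ∃ j, j < ω.Mv ∧ (ω.jFace h j).side (ω.jOut hr h j) = (farW w).side .N := by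
  have hM := ω.three_le_Mv hr h
  have hF := ω.fh_lt h
  have hlen : ω.2.arcs.length = ω.2.firstHitG + ω.Mv := len_eq h
  obtain ⟨-, -, h12⟩ := ω.firstSide_exit_return_distinct hr h
  rcases z1_eq_W_or_N hh hr h hS with e | e
  · have e2 : ω.1 = .N := by
      rcases fst_eq_W_or_N hh hr h hS with e2 | e2
      · exact absurd (e.trans e2.symm) h12
      · exact e2
    refine ⟨ω.Mv - 1, by omega, ?_⟩
    rw [side_jOut (hr := hr) h (by omega), show ω.2.firstHitG + (ω.Mv - 1) + 1 = ω.2.arcs.length by omega,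
      ω.2.nth_length, e2]
  · exact ⟨0, by omega, by rw [jFace_zero, jOut_zero, e]⟩

/-- ★★★ **THE PREFIX-LOOP SEPARATION LEMMA.** Hole absent; a class-`B2a` UNDER-walk at the far cell (first side `S`)
whose excursion polygon crosses the bottom side of the cell east of the root plaquette (the top side of the eastern
pocket). Then the PREFIX crosses the bottom side of the root plaquette: `nth i = w.side S` for some
`1 ≤ i < firstHitG`. Proof: the prefix, closed through the far cell and the hole, is a closed polygon `C` missed
by the excursion polygon `J` (§2), so `C` has one winding number `ν` along `J`; `J` passes through the midpoint of
the far cell's top side (a stub) and through the midpoint of that eastern bottom side; the first is joined to the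
upper corner of the root edge along the top sides of the far cell and of the hole, the second to the lower corner
along the bottom sides of the cell east of `w` and — if the prefix does not cross it — of `w`, all off `C`; but the
winding numbers of `C` about the two corners of the root edge differ by one (§3).
[cite: CourantRobbins1958, Ch. V Appendix §2 (The Jordan Curve Theorem for Polygons: the even–odd rule)]
[cite: AhlforsCA1979, Ch. 4 §2.1 (index of a point with respect to a closed curve)]
[cite: Glazman2015WeightedSAW, Lemma 3.1 (proof, pp. 6–7: the classes of walks through a rhombus)] -/
theorem exists_prefix_nth_eq_root_S (hh : holeFaceW w ∉ D) (hr : RootedFace D (w.side .W) (farW w))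
    (h : ω.IsB2a) (hS : ω.2.firstSideG = .S)
    (hJ : ∃ j, j < ω.Mv ∧ (ω.jFace h j).side (ω.jOut hr h j) = (rootE w).side .S) :
    ∃ i, 1 ≤ i ∧ i < ω.2.firstHitG ∧ ω.2.nth i = w.side .S := by
  have hM := ω.three_le_Mv hr h
  have hF := ω.fh_lt h
  have h1 := ω.one_le_firstHitG_far
  have hlen : ω.2.arcs.length = ω.2.firstHitG + ω.Mv := len_eq h
  set F := ω.2.firstHitG with hFdef
  set n := ω.2.arcs.length with hndef
  have hnthF : ω.2.nth F = (farW w).side .S := by rw [hFdef, ω.2.nth_firstHitG, hS]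
  by_contra hP
  push Not at hP
  have hP' : ∀ i, 1 ≤ i → i ≤ F → ω.2.nth i ≠ w.side .S := by
    intro i hi1 hiF e
    rcases Nat.lt_or_ge i F with hl | hl
    · exact hP i hi1 hl e
    · have ei : i = F := by omega
      rw [ei, hnthF] at e
      exact farW_side_ne_rootS_side w .S .N (e.trans (root_side_S_eq_rootS_side_N w))
  obtain ⟨j, hj, hje⟩ := hJ
  -- the four auxiliary points
  set q1 : ℂ := toC ((holeFaceW w).base + Side.N.endA) with hq1
  set mN : ℂ := toC (midPt ((farW w).side .N)) with hmN
  set q2 : ℂ := toC ((rootE w).base + Side.S.endA) with hq2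
  set mE : ℂ := toC (midPt ((rootE w).side .S)) with hmE
  -- P1: the top side of the hole
  have hP1 : segment ℝ (cHi w) q1 = sideSeg (holeFaceW w) .N := by
    rw [segment_symm, sideSeg, cHi]
    congr 2
    obtain ⟨a, b⟩ := w; simp [holeFaceW, Face.base, Side.endB]; ring
  have w1 : ω.windC (cHi w) = ω.windC q1 := by
    refine windC_eq_of_segment fun z hz k hk hzk => ?_
    rw [hP1] at hz
    obtain ⟨i, hi1, hiF, e⟩ := exists_nth_eq_of_mem_pCedge_sideSeg hh h hS hk hzk hz
      (fun q hq => not_mem_sideSeg_N_of_mem_fSeg_hSeg (by simp [holeFaceW]) hq)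
    have hd := ω.2.door_nth (j := i) (by omega) (by omega)
    rw [e] at hd
    have : ((holeFaceW w).side .N).faces.1 = holeFaceW w := by
      obtain ⟨a, b⟩ := w; simp [holeFaceW, Face.side, MidEdge.faces]
    rw [this] at hd
    exact hh hd.1
  -- P2: the right half of the top side of the far cell
  have hP2 : segment ℝ q1 mN ⊆ sideSeg (farW w) .N := by
    refine (convex_segment _ _).segment_subset ?_ (toC_midPt_side_mem_sideSeg _ _)
    have e : q1 = toC ((farW w).base + Side.N.endB) := by
      rw [hq1]; congr 1; obtain ⟨a, b⟩ := w; simp [holeFaceW, farW, Face.base, Side.endA, Side.endB]; ring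
    rw [e]; exact right_mem_segment _ _ _
  have w2 : ω.windC q1 = ω.windC mN := by
    refine windC_eq_of_segment fun z hz k hk hzk => ?_
    obtain ⟨i, hi1, hiF, e⟩ := exists_nth_eq_of_mem_pCedge_sideSeg hh h hS hk hzk (hP2 hz)
      (fun q hq => not_mem_sideSeg_N_of_mem_fSeg_hSeg (by simp [farW]) hq)
    have hle := firstHitG_le_of_nth_eq (ω := ω) (by omega) e
    have ei : i = F := by omega
    rw [ei, hnthF] at e
    exact absurd (Face.side_injective (farW w) e) (by decide)
  -- P3: the bottom side of the root plaquette
  have hP3 : segment ℝ (cLo w) q2 = sideSeg w .S := by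
    have e1 : cLo w = toC (w.base + Side.S.endA) := rfl
    have e2 : q2 = toC (w.base + Side.S.endB) := by
      rw [hq2]; congr 1; obtain ⟨a, b⟩ := w; simp [rootE, Face.base, Side.endA, Side.endB]; ring
    rw [e1, e2, sideSeg]
  have w3 : ω.windC (cLo w) = ω.windC q2 := by
    refine windC_eq_of_segment fun z hz k hk hzk => ?_
    rw [hP3] at hz
    obtain ⟨i, hi1, hiF, e⟩ := exists_nth_eq_of_mem_pCedge_sideSeg hh h hS hk hzk hz
      (fun q hq => not_mem_sideSeg_S_of_mem_fSeg_hSeg rfl le_rfl hq)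
    exact hP' i hi1 hiF e
  -- P4: the left half of the bottom side of the cell east of the root plaquette
  have hP4 : segment ℝ q2 mE ⊆ sideSeg (rootE w) .S :=
    (convex_segment _ _).segment_subset (left_mem_segment _ _ _) (toC_midPt_side_mem_sideSeg _ _)
  have w4 : ω.windC q2 = ω.windC mE := by
    refine windC_eq_of_segment fun z hz k hk hzk => ?_
    obtain ⟨i, hi1, hiF, e⟩ := exists_nth_eq_of_mem_pCedge_sideSeg hh h hS hk hzk (hP4 hz)
      (fun q hq => not_mem_sideSeg_S_of_mem_fSeg_hSeg (by simp [rootE]) (by simp [rootE]) hq)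
    rw [← hje, side_jOut (hr := hr) h hj] at e
    have := ω.2.nth_inj (by omega) (by omega) e
    omega
  -- the two midpoints lie on `J`
  obtain ⟨j₀, hj₀, hj₀e⟩ := exists_jOut_eq_farW_N hh hr h hS
  have wN : ω.windC mN = ω.windC (ω.pJ hr h 0) := by
    refine windC_pJ_edge hh hr h hS (k := 2 * j₀) (by omega) ?_
    rw [segment_pJ_even h hj₀, hj₀e]
    exact toC_midPt_mem_crossSeg _
  have wE : ω.windC mE = ω.windC (ω.pJ hr h 0) := by
    refine windC_pJ_edge hh hr h hS (k := 2 * j) (by omega) ?_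
    rw [segment_pJ_even h hj, hje]
    exact toC_midPt_mem_crossSeg _
  have := windC_jump hh h hS
  rw [w1, w2, wN, ← wE, ← w4, ← w3, sub_self] at this
  exact zero_ne_one this

/-! ## §5 The structural `w₁`-kill below the root plaquette for EVERY wound under-walk, and the east pair of
LAW L without directness -/

open Literature.Barriers.CriticalPhenomena.PlaquetteWalk (mirrorRow mirrorRowFace mirrorSide mirrorKind mirrorArc
  mirrorRow_side arcsOf_map_mirrorRow arcKind_mirrorSide mirrorRowFace_mirrorRowFace mirrorSide_mirrorSide
  mirrorKind_mirrorKind)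

/-- A face having the mid-edge `e` as a side is one of the two faces of `e`. [cite: GlazmanManolescu2019, §1 (the lattice of rhombi and its mid-edges)] -/
private theorem face_of_side_eqP {F : Face} {s : Side} {e : MidEdge} (h : F.side s = e) : F = e.faces.1 ∨ F = e.faces.2 :=
  (Face.exists_side_eq_iff F e).1 ⟨s, h⟩

/-- Side bookkeeping: an arc with an `N` end and an arc with an `E` end in one rhombus, with four distinct ends and
neither straight, are the two `θ`-corner arcs `{N, W}` and `{E, S}`. [cite: GlazmanManolescu2019, §1, Fig. 1] -/
private theorem corner_corner_of_N_of_E : ∀ {x y s t : Side}, x ≠ y → y ≠ x.opp → s ≠ t → t ≠ s.opp → s ≠ x →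
    s ≠ y → t ≠ x → t ≠ y → (x = .N ∨ y = .N) → (s = .E ∨ t = .E) →
      arcKind x y = .corner ∧ arcKind s t = .corner := by
  decide

/-- ★★ **THE DOUBLE θ-CORNER BELOW THE ROOT PLAQUETTE from a prefix crossing of its bottom side.** Eastern kill
geometry (`K_S1 = (w.1 + 1, w.2 − 2)` and the cell east of the eastern pocket absent): if the PREFIX of a class-`B2a`
walk at the far cell crosses the bottom side of the root plaquette and the EXCURSION crosses the top side of the
eastern pocket, then the cell below the root plaquette carries a prefix arc with an `N` end and — the pocket's only
other door being its `W` side — an excursion arc with an `E` end: its two `θ`-corners.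
[cite: GlazmanManolescu2019, §1, Fig. 1 (two arcs at the two θ-corners weigh w₁)]
[cite: Glazman2015WeightedSAW, Lemma 3.1 (proof, pp. 6–7: the classes of walks through a rhombus)] -/
theorem kindsIn_rootS_eq_of_prefix_cross (hK : killSE w ∉ D) (hPE : pocketSEE w ∉ D)
    (ω : ΩG D (w.side .W) (farW w)) (hr : RootedFace D (w.side .W) (farW w)) (h : ω.IsB2a)
    (hpre : ∃ i, 1 ≤ i ∧ i < ω.2.firstHitG ∧ ω.2.nth i = w.side .S)
    (hexc : ∃ i, ω.2.firstHitG ≤ i ∧ i < ω.2.arcs.length ∧ ω.2.nth (i + 1) = (pocketSE w).side .N) :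
    ω.2.kindsIn (rootS w) = [.corner, .corner] := by
  have hF := ω.fh_lt h
  have hfcF : ω.2.fc ω.2.firstHitG = farW w := (fc_fh ω hr h).1
  set F := ω.2.firstHitG with hFdef
  set n := ω.2.arcs.length with hndef
  -- the prefix arc in `rootS w` with an `N` end
  obtain ⟨i₀, hi₀1, hi₀F, hnth₀⟩ := hpre
  have hm : ∃ m, m < F ∧ ω.2.fc m = rootS w ∧ (ω.2.sIn m = .N ∨ ω.2.sOut m = .N) := by
    obtain ⟨hin, -, -⟩ := ω.2.side_sIn_nth (i := i₀) (by omega)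
    obtain ⟨-, hout, -⟩ := ω.2.side_sIn_nth (i := i₀ - 1) (by omega)
    rw [show i₀ - 1 + 1 = i₀ by omega, hnth₀, root_side_S_eq_rootS_side_N] at hout
    rw [hnth₀, root_side_S_eq_rootS_side_N] at hin
    have hfi := face_of_side_eqP hin
    rw [← root_side_S_eq_rootS_side_N, root_side_S_faces] at hfi
    simp only at hfi
    rcases hfi with e | e
    · exact ⟨i₀, hi₀F, e, Or.inl (Face.side_injective (rootS w) (by rw [e] at hin; exact hin))⟩
    · have hfi' := face_of_side_eqP hout
      rw [← root_side_S_eq_rootS_side_N, root_side_S_faces] at hfi'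
      simp only at hfi'
      have hsucc : ω.2.fc (i₀ - 1) ≠ ω.2.fc (i₀ - 1 + 1) := YBWalk.fc_succ_ne (by omega)
      rw [show i₀ - 1 + 1 = i₀ by omega, e] at hsucc
      rcases hfi' with e' | e'
      · exact ⟨i₀ - 1, by omega, e', Or.inr (Face.side_injective (rootS w) (by rw [e'] at hout; exact hout))⟩
      · exact absurd e' hsucc
  obtain ⟨m, hmF, hfm, hmN⟩ := hm
  -- the excursion arc in `rootS w` with an `E` end (the pocket argument of §10 of the parent file)
  obtain ⟨i, hFi, hin', hnth'⟩ := hexc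
  have hi1 : i + 1 < n := by
    rcases Nat.lt_or_ge (i + 1) n with hl | hl
    · exact hl
    · exfalso
      have e : i + 1 = n := by omega
      rw [e, ω.2.nth_length] at hnth'
      exact farW_side_ne_pocketSE_side w ω.1 .N hnth'
  have hlastP : ∀ t : Side, ω.2.nth n ≠ (pocketSE w).side t := by
    intro t; rw [ω.2.nth_length]; exact farW_side_ne_pocketSE_side w ω.1 t
  have hlastR : ∀ t : Side, ω.2.nth n ≠ (rootS w).side t := by
    intro t; rw [ω.2.nth_length]; exact farW_side_ne_rootS_side w ω.1 t
  obtain ⟨-, hout_i, -⟩ := ω.2.side_sIn_nth (i := i) (by omega)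
  obtain ⟨hin_i1, -, -⟩ := ω.2.side_sIn_nth (i := i + 1) hi1
  rw [hnth'] at hout_i hin_i1
  have hfi := face_of_side_eqP hout_i
  have hfi1 := face_of_side_eqP hin_i1
  rw [pocketSE_side_N_faces] at hfi hfi1
  simp only at hfi hfi1
  have hsucc : ω.2.fc i ≠ ω.2.fc (i + 1) := YBWalk.fc_succ_ne hi1
  have hk : ∃ k, F < k ∧ k < n ∧ ω.2.fc k = pocketSE w ∧ (ω.2.sIn k = .N ∨ ω.2.sOut k = .N) := by
    rcases hfi1 with e1 | e1
    · exact ⟨i + 1, by omega, hi1, e1, Or.inl (Face.side_injective (pocketSE w) (by rw [e1] at hin_i1; exact hin_i1))⟩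
    · have e0 : ω.2.fc i = pocketSE w := by
        rcases hfi with e | e
        · exact e
        · exact absurd (e.trans e1.symm) hsucc
      refine ⟨i, ?_, by omega, e0, Or.inr (Face.side_injective (pocketSE w) (by rw [e0] at hout_i; exact hout_i))⟩
      rcases Nat.lt_or_ge F i with hl | hl
      · exact hl
      · exfalso
        have eF : i = F := by omega
        rw [eF, hfcF] at e0
        exact farW_side_ne_pocketSE_side w .N .N (by rw [← e0])
  obtain ⟨k, hFk, hkn, hfk, hN⟩ := hk
  obtain ⟨hin, hout, hne⟩ := ω.2.side_sIn_nth hkn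
  rw [hfk] at hin hout
  have other : ∀ t : Side, t ≠ .N →
      ((pocketSE w).side t = ω.2.nth k ∨ (pocketSE w).side t = ω.2.nth (k + 1)) → t = .W := by
    intro t htN ht
    have hdoor : ((pocketSE w).side t).faces.1 ∈ D ∧ ((pocketSE w).side t).faces.2 ∈ D := by
      rcases ht with e | e
      · rw [e]; exact ω.2.door_nth (j := k) (by omega) hkn
      · have hk1 : k + 1 < n := by
          rcases Nat.lt_or_ge (k + 1) n with hl | hl
          · exact hl
          · exact absurd (by rw [show n = k + 1 by omega]; exact e.symm) (hlastP t)
        rw [e]; exact ω.2.door_nth (j := k + 1) (by omega) hk1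
    cases t
    · rfl
    · rw [pocketSE_side_E_faces] at hdoor; exact absurd hdoor.2 hPE
    · rw [pocketSE_side_S_faces] at hdoor; exact absurd hdoor.1 hK
    · exact absurd rfl htN
  have hR : ∃ k', F < k' ∧ k' < n ∧ ω.2.fc k' = rootS w ∧ (ω.2.sIn k' = .E ∨ ω.2.sOut k' = .E) := by
    rcases hN with e | e
    · have ht := other (ω.2.sOut k) (fun h' => hne (e.trans h'.symm)) (Or.inr (by rw [hout]))
      rw [ht, pocketSE_side_W] at hout
      have hk1 : k + 1 < n := by
        rcases Nat.lt_or_ge (k + 1) n with hl | hl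
        · exact hl
        · exact absurd (by rw [show n = k + 1 by omega]; exact hout.symm) (hlastR .E)
      obtain ⟨hi', -, -⟩ := ω.2.side_sIn_nth (i := k + 1) hk1
      rw [← hout] at hi'
      have hf' := face_of_side_eqP hi'
      rw [← pocketSE_side_W, pocketSE_side_W_faces] at hf'
      simp only at hf'
      have hsucc' : ω.2.fc k ≠ ω.2.fc (k + 1) := YBWalk.fc_succ_ne hk1
      rw [hfk] at hsucc'
      rcases hf' with e' | e'
      · exact ⟨k + 1, by omega, hk1, e', Or.inl (Face.side_injective (rootS w) (by rw [e'] at hi'; exact hi'))⟩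
      · exact absurd e'.symm hsucc'
    · have ht := other (ω.2.sIn k) (fun h' => hne (h'.trans e.symm)) (Or.inl (by rw [hin]))
      rw [ht, pocketSE_side_W] at hin
      have hk0 : 1 ≤ k := by omega
      obtain ⟨-, ho, -⟩ := ω.2.side_sIn_nth (i := k - 1) (by omega)
      rw [show k - 1 + 1 = k by omega, ← hin] at ho
      have hf' := face_of_side_eqP ho
      rw [← pocketSE_side_W, pocketSE_side_W_faces] at hf'
      simp only at hf'
      have hsucc' : ω.2.fc (k - 1) ≠ ω.2.fc (k - 1 + 1) := YBWalk.fc_succ_ne (by omega)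
      rw [show k - 1 + 1 = k by omega, hfk] at hsucc'
      rcases hf' with e' | e'
      · refine ⟨k - 1, ?_, by omega, e', Or.inr (Face.side_injective (rootS w) (by rw [e'] at ho; exact ho))⟩
        rcases Nat.lt_or_ge F (k - 1) with hl | hl
        · exact hl
        · exfalso
          have eF : k - 1 = F := by omega
          rw [eF, hfcF] at e'
          exact rootS_ne_farW w e'.symm
      · exact absurd e' hsucc'
  obtain ⟨k', hFk', hk'n, hfk', hE'⟩ := hR
  -- two arcs in `rootS w`: the prefix arc `m` with an `N` end and the excursion arc `k'` with an `E` end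
  have hf : ω.2.fc k' = ω.2.fc m := hfk'.trans hfm.symm
  obtain ⟨hopp, d1, d2, d3, d4⟩ := YBWalk.not_straight_of_two_arcs (γ := ω.2) (i := m) (i' := k') (by omega) hk'n
    (by omega) hf
  obtain ⟨hopp', -, -, -, -⟩ := YBWalk.not_straight_of_two_arcs (γ := ω.2) (i := k') (i' := m) hk'n (by omega)
    (by omega) hf.symm
  have hxy := (ω.2.side_sIn_nth (i := m) (by omega)).2.2
  have hst := (ω.2.side_sIn_nth hk'n).2.2
  obtain ⟨c1, c2⟩ := corner_corner_of_N_of_E hxy hopp hst hopp' d1 d2 d3 d4 hmN hE'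
  rw [← hfm]
  exact ω.2.kindsIn_eq_corner_corner (m := m) (m' := k') (by omega) hk'n (by omega) hf c1 c2

/-- ★★★ **THE DICHOTOMY FOR A WOUND UNDER-WALK (canonical orientation).** Eastern kill geometry (hole, `K_S1`, the
cell east of the eastern pocket absent, the bottom line of the root row uncrossable for `x ≥ w.1 + 2`): a class-`B2a`
under-walk at the far cell whose excursion polygon winds around the root doubles the cell BELOW the root plaquette or
the root plaquette ITSELF through the two `θ`-corners. (The odd eastern crossing of the parity law is the bottom side
of `w` — then `w` doubles, §11 (a) of the parent file — or the top side of the eastern pocket — then the separation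
lemma puts the prefix through the bottom side of `w`, and `rootS w` doubles.)
[cite: GlazmanManolescu2019, §1, Fig. 1 (two arcs at the two θ-corners weigh w₁)]
[cite: CourantRobbins1958, Ch. V Appendix §2 (The Jordan Curve Theorem for Polygons: the even–odd rule)]
[cite: Glazman2015WeightedSAW, Lemma 3.1 (proof, pp. 6–7: the classes of walks through a rhombus)] -/
theorem kindsIn_rootS_or_root_eq_of_AJ_ne_zero_under (hh : holeFaceW w ∉ D)
    (hrow : ∀ x : ℤ, w.1 + 2 ≤ x → (x, w.2) ∉ D ∨ (x, w.2 - 1) ∉ D) (hK : killSE w ∉ D) (hPE : pocketSEE w ∉ D)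
    (ω : ΩG D (w.side .W) (farW w)) (hr : RootedFace D (w.side .W) (farW w)) (h : ω.IsB2a)
    (hS : ω.2.firstSideG = .S) (hA : ω.AJ hr h (toC (midPt (w.side .W))) ≠ 0) :
    ω.2.kindsIn (rootS w) = [.corner, .corner] ∨ ω.2.kindsIn w = [.corner, .corner] := by
  have hF := ω.fh_lt h
  obtain ⟨⟨i, hFi, hi1, hnth⟩, -⟩ := ω.exists_nth_eq_east_sides_of_AJ_ne_zero hh hrow hr h hA
  rcases hnth with e | e
  · exact Or.inr (ω.kindsIn_root_eq_of_cross_root_S hh hr h ⟨i, hFi.le, by omega, e⟩).2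
  · left
    have hJ : ∃ j, j < ω.Mv ∧ (ω.jFace h j).side (ω.jOut hr h j) = (rootE w).side .S := by
      refine ⟨i - ω.2.firstHitG, by unfold ΩG.Mv; omega, ?_⟩
      rw [side_jOut (hr := hr) h (by unfold ΩG.Mv; omega),
        show ω.2.firstHitG + (i - ω.2.firstHitG) + 1 = i + 1 by omega, e, rootE_side_S]
    obtain ⟨i₀, hi₀1, hi₀F, hnth₀⟩ := exists_prefix_nth_eq_root_S hh hr h hS hJ
    exact kindsIn_rootS_eq_of_prefix_cross hK hPE ω hr h ⟨i₀, hi₀1, hi₀F, hnth₀⟩ ⟨i, hFi.le, by omega, e⟩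

/-- ★ **NO WOUND UNDER-WALK RUNS STRAIGHT EAST FIRST.** Hole absent and the bottom line of the root row uncrossable for
`x ≥ w.1 + 2`: a class-`B2a` under-walk whose first arc crosses the root plaquette straight to its `E` side has an
excursion polygon NOT winding around the root (`AJ = 0` at the root's midpoint). For the odd eastern crossing would
be `w.S` — forcing the first arc north (parent §11 (a)) — or the eastern pocket's top side — forcing, by the separation
lemma, a second prefix arc in `w` next to the straight one, which the walk's simplicity forbids. (So the parent's
§11 (b) is vacuous in this geometry.) [cite: GlazmanManolescu2019, Lemma 2.1 (statement, "in the form given in [Gl]")]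
[cite: CourantRobbins1958, Ch. V Appendix §2 (The Jordan Curve Theorem for Polygons: the even–odd rule)]
[cite: Glazman2015WeightedSAW, Lemma 3.1 (proof, pp. 6–7: the classes of walks through a rhombus)] -/
theorem AJ_root_eq_zero_of_under_east (hh : holeFaceW w ∉ D)
    (hrow : ∀ x : ℤ, w.1 + 2 ≤ x → (x, w.2) ∉ D ∨ (x, w.2 - 1) ∉ D)
    (ω : ΩG D (w.side .W) (farW w)) (hr : RootedFace D (w.side .W) (farW w)) (h : ω.IsB2a)
    (hS : ω.2.firstSideG = .S) (hE : ω.2.nth 1 = w.side .E) : ω.AJ hr h (toC (midPt (w.side .W))) = 0 := by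
  have hF := ω.fh_lt h
  have h1 := ω.one_le_firstHitG_far
  by_contra hA
  obtain ⟨⟨i, hFi, hi1, hnth⟩, -⟩ := ω.exists_nth_eq_east_sides_of_AJ_ne_zero hh hrow hr h hA
  rcases hnth with e | e
  · have hN := (ω.kindsIn_root_eq_of_cross_root_S hh hr h ⟨i, hFi.le, by omega, e⟩).1
    rw [hE] at hN
    exact absurd (Face.side_injective w hN) (by decide)
  · have hJ : ∃ j, j < ω.Mv ∧ (ω.jFace h j).side (ω.jOut hr h j) = (rootE w).side .S := by
      refine ⟨i - ω.2.firstHitG, by unfold ΩG.Mv; omega, ?_⟩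
      rw [side_jOut (hr := hr) h (by unfold ΩG.Mv; omega),
        show ω.2.firstHitG + (i - ω.2.firstHitG) + 1 = i + 1 by omega, e, rootE_side_S]
    obtain ⟨i₀, hi₀1, hi₀F, hnth₀⟩ := exists_prefix_nth_eq_root_S hh hr h hS hJ
    -- a second prefix arc in `w`, at index `i₀ - 1` or `i₀`
    have hfc0 : ω.2.fc 0 = w := fc_zero_eq_root w hh ω.2 (by omega)
    have hsIn0 : ω.2.sIn 0 = .W := ω.sIn_zero_eq_W hh (by omega)
    have hsOut0 : ω.2.sOut 0 = .E := by
      obtain ⟨-, hout, -⟩ := ω.2.side_sIn_nth (i := 0) (by omega)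
      rw [hfc0, zero_add, hE] at hout
      exact Face.side_injective w hout
    have hm : ∃ m, 1 ≤ m ∧ m < ω.2.firstHitG ∧ ω.2.fc m = w := by
      obtain ⟨hin, -, -⟩ := ω.2.side_sIn_nth (i := i₀) (by omega)
      obtain ⟨-, hout, -⟩ := ω.2.side_sIn_nth (i := i₀ - 1) (by omega)
      rw [show i₀ - 1 + 1 = i₀ by omega, hnth₀] at hout
      rw [hnth₀] at hin
      have hfi := face_of_side_eqP hin
      have hfi' := face_of_side_eqP hout
      rw [root_side_S_faces] at hfi hfi'
      simp only at hfi hfi'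
      have hsucc : ω.2.fc (i₀ - 1) ≠ ω.2.fc (i₀ - 1 + 1) := YBWalk.fc_succ_ne (by omega)
      rw [show i₀ - 1 + 1 = i₀ by omega] at hsucc
      rcases hfi with e0 | e0
      · rcases hfi' with e1 | e1
        · exact absurd (e1.trans e0.symm) hsucc
        · refine ⟨i₀ - 1, ?_, by omega, e1⟩
          by_contra hlt
          have e2 : i₀ = 1 := by omega
          rw [e2, hE] at hnth₀
          exact absurd (Face.side_injective w hnth₀) (by decide)
      · exact ⟨i₀, hi₀1, hi₀F, e0⟩
    obtain ⟨m, hm1, hmF, hfm⟩ := hm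
    obtain ⟨hopp, -, -, -, -⟩ := YBWalk.not_straight_of_two_arcs (γ := ω.2) (i := 0) (i' := m) (by omega) (by omega)
      (by omega) (hfm.trans hfc0.symm)
    rw [hsIn0, hsOut0] at hopp
    exact hopp rfl

/-- ★ Hence, in that geometry, **no WOUND under-walk has its first arc running east** (either orientation of the winding
witness: the reversed companion has the same prefix). [cite: GlazmanManolescu2019, Lemma 2.1 (statement, "in the form given in [Gl]")]
[cite: CourantRobbins1958, Ch. V Appendix §2 (The Jordan Curve Theorem for Polygons: the even–odd rule)] -/
theorem nth_one_ne_root_E_of_wound_under (hh : holeFaceW w ∉ D)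
    (hrow : ∀ x : ℤ, w.1 + 2 ≤ x → (x, w.2) ∉ D ∨ (x, w.2 - 1) ∉ D)
    (ω : ΩG D (w.side .W) (farW w)) (hr : RootedFace D (w.side .W) (farW w)) (h : ω.IsB2a)
    (hS : ω.2.firstSideG = .S) {θ : ℝ}
    (hW : ω.WE (fun _ => θ) ≠ excursionWinding θ ω.2.firstSideG (ω.z1 hr h) ω.1) : ω.2.nth 1 ≠ w.side .E := by
  intro hE
  rcases ω.AJ_ne_zero_or_rev_of_wound hr h θ hW with hA | hA
  · exact hA (AJ_root_eq_zero_of_under_east hh hrow ω hr h hS hE)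
  · have h' := ω.rev_isB2a hr h
    have hn : 1 ≤ ω.2.arcs.length := by have := ω.fh_lt h; omega
    have hS' : (ω.rev hr).2.firstSideG = .S := by rw [ω.rev_firstSide hr h]; exact hS
    have hE' : (ω.rev hr).2.nth 1 = w.side .E := by
      rw [rev_snd_nth ω hr h hn, if_pos (ω.one_le_firstHitG_far)]; exact hE
    exact hA (AJ_root_eq_zero_of_under_east hh hrow (ω.rev hr) hr h' hS' hE')

/-- ★★★★ **THE STRUCTURAL `K_S1` KILL FOR EVERY WOUND UNDER-WALK** — the east pair of LAW L without any directness
hypothesis: in the eastern kill geometry every WOUND class-`B2a` UNDER-walk at the far cell (either orientation of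
the winding witness: the reversed companion has the same prefix, the same first side and the same kinds off the far
cell) is NOT `w₁`-free off the far cell. [cite: GlazmanManolescu2019, §1, Fig. 1 and the remark after eq. (1) («w₁ = 0 at θ = 2π/3»)]
[cite: CourantRobbins1958, Ch. V Appendix §2 (The Jordan Curve Theorem for Polygons: the even–odd rule)]
[cite: Glazman2015WeightedSAW, Lemma 3.1 (proof, pp. 6–7: the classes of walks through a rhombus)] -/
theorem not_W1FreeOff_farW_of_wound_under_east (hh : holeFaceW w ∉ D)
    (hrow : ∀ x : ℤ, w.1 + 2 ≤ x → (x, w.2) ∉ D ∨ (x, w.2 - 1) ∉ D) (hK : killSE w ∉ D) (hPE : pocketSEE w ∉ D)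
    (ω : ΩG D (w.side .W) (farW w)) (hr : RootedFace D (w.side .W) (farW w)) (h : ω.IsB2a)
    (hS : ω.2.firstSideG = .S) {θ : ℝ}
    (hW : ω.WE (fun _ => θ) ≠ excursionWinding θ ω.2.firstSideG (ω.z1 hr h) ω.1) : ¬ω.2.W1FreeOff (farW w) := by
  have key : ω.2.kindsIn (rootS w) = [.corner, .corner] ∨ ω.2.kindsIn w = [.corner, .corner] := by
    rcases ω.AJ_ne_zero_or_rev_of_wound hr h θ hW with hA | hA
    · exact kindsIn_rootS_or_root_eq_of_AJ_ne_zero_under hh hrow hK hPE ω hr h hS hA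
    · have h' := ω.rev_isB2a hr h
      have hS' : (ω.rev hr).2.firstSideG = .S := by rw [ω.rev_firstSide hr h]; exact hS
      have perm : ∀ {g : Face}, g ≠ farW w → (ω.rev hr).2.kindsIn g = [.corner, .corner] →
          ω.2.kindsIn g = [.corner, .corner] := by
        intro g hg hk
        have hperm := ω.kindsIn_rev_perm hr h hg
        rw [hk] at hperm
        have hp : (ω.2.kindsIn g).Perm (List.replicate 2 .corner) := hperm.symm
        exact List.perm_replicate.1 hp
      rcases kindsIn_rootS_or_root_eq_of_AJ_ne_zero_under hh hrow hK hPE (ω.rev hr) hr h' hS' hA with hk | hk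
      · exact Or.inl (perm (rootS_ne_farW w) hk)
      · exact Or.inr (perm (root_ne_farW w) hk)
  intro hfree
  rcases key with hk | hk
  · have hmem : rootS w ∈ ω.2.facesVisited := by
      by_contra hn
      rw [YBWalk.kindsIn_eq_nil hn] at hk
      exact List.cons_ne_nil _ _ hk.symm
    exact hfree _ hmem (rootS_ne_farW w) hk
  · have hmem : w ∈ ω.2.facesVisited := by
      by_contra hn
      rw [YBWalk.kindsIn_eq_nil hn] at hk
      exact List.cons_ne_nil _ _ hk.symm
    exact hfree _ hmem (root_ne_farW w) hk

/-- ★★★★ The companion file's hypothesis `hS₁` («every wound under-walk is `w₁`-marked off the far cell») in the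
`K_S1` geometry — DISCHARGED STRUCTURALLY, with no directness hypothesis.
[cite: GlazmanManolescu2019, §1, remark after eq. (1)] [cite: CourantRobbins1958, Ch. V Appendix §2 (the even–odd rule)] -/
theorem under_w1_killed_of_killSE (hh : holeFaceW w ∉ D)
    (hrow : ∀ x : ℤ, w.1 + 2 ≤ x → (x, w.2) ∉ D ∨ (x, w.2 - 1) ∉ D) (hK : killSE w ∉ D) (hPE : pocketSEE w ∉ D)
    (hr : RootedFace D (w.side .W) (farW w)) (θ : ℝ) :
    ∀ (ω : ΩG D (w.side .W) (farW w)) (h : ω.IsB2a), ω.2.firstSideG = .S →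
      ω.WE (fun _ => θ) ≠ excursionWinding θ ω.2.firstSideG (ω.z1 hr h) ω.1 → ¬ω.2.W1FreeOff (farW w) :=
  fun ω h hS hW => not_W1FreeOff_farW_of_wound_under_east hh hrow hK hPE ω hr h hS hW

/-- ★★★★ **THE STRUCTURAL `K_N2` KILL FOR EVERY WOUND OVER-WALK** (row-mirror twin): north-eastern kill geometry
(hole, `K_N2 = (w.1 + 1, w.2 + 2)`, `(w.1 + 2, w.2 + 1)` absent, top line of the root row uncrossable for
`x ≥ w.1 + 2`) ⇒ every wound class-`B2a` OVER-walk at the far cell is NOT `w₂`-free off the far cell. Transport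
through the reflection in the root row (`ΩG.mirrorFar`): over-walks go to under-walks of the reflected domain, wound to
wound, and a rhombus doubled through its `θ`-corners by the reflected walk is the reflection of a rhombus doubled
through its `(π − θ)`-corners. [cite: GlazmanManolescu2019, §1, Fig. 1 and the paragraph of Fig. 2 («if θ = π/3, then w₂ = 0»)]
[cite: CourantRobbins1958, Ch. V Appendix §2 (the even–odd rule)] [cite: Glazman2015WeightedSAW, Lemma 3.1 (proof, pp. 6–7)] -/
theorem not_W2FreeOff_farW_of_wound_over_east (hh : holeFaceW w ∉ D)
    (hrow : ∀ x : ℤ, w.1 + 2 ≤ x → (x, w.2) ∉ D ∨ (x, w.2 + 1) ∉ D) (hK : killNE w ∉ D) (hPE : pocketNEE w ∉ D)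
    (ω : ΩG D (w.side .W) (farW w)) (hr : RootedFace D (w.side .W) (farW w)) (h : ω.IsB2a)
    (hN : ω.2.firstSideG = .N) {θ : ℝ}
    (hW : ω.WE (fun _ => θ) ≠ excursionWinding θ ω.2.firstSideG (ω.z1 hr h) ω.1) : ¬ω.2.W2FreeOff (farW w) := by
  have hr' := rootedFace_rowMirrorDom w hr
  have h' := ω.mirrorFar_isB2a hr h
  have hh' : holeFaceW w ∉ rowMirrorDom w D := by rwa [mem_rowMirrorDom, mirrorRowFace_holeFaceW]
  have hK' : killSE w ∉ rowMirrorDom w D := by rwa [mem_rowMirrorDom, mirrorRowFace_killSE]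
  have hPE' : pocketSEE w ∉ rowMirrorDom w D := by rwa [mem_rowMirrorDom, mirrorRowFace_pocketSEE]
  have hrow' : ∀ x : ℤ, w.1 + 2 ≤ x → (x, w.2) ∉ rowMirrorDom w D ∨ (x, w.2 - 1) ∉ rowMirrorDom w D := by
    intro x hx
    rw [mem_rowMirrorDom, mem_rowMirrorDom, mirrorRowFace_row, mirrorRowFace_row_pred]
    exact hrow x hx
  have hS' : ω.mirrorFar.2.firstSideG = .S := by rw [ω.mirrorFar_firstSideG, hN]; rfl
  have hkill := not_W1FreeOff_farW_of_wound_under_east hh' hrow' hK' hPE' ω.mirrorFar hr' h' hS'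
    (ω.mirrorFar_wound hr h hW)
  intro hfree
  apply hkill
  intro g hg hgf hk
  have hk2 := ω.kindsIn_eq_coCorner_of_mirrorFar_corner hk
  have hmem : mirrorRowFace w.2 g ∈ ω.2.facesVisited := by
    by_contra hn
    rw [YBWalk.kindsIn_eq_nil hn] at hk2
    exact List.cons_ne_nil _ _ hk2.symm
  have hne : mirrorRowFace w.2 g ≠ farW w := by
    intro e
    apply hgf
    have e' := congrArg (mirrorRowFace w.2) e
    rw [mirrorRowFace_mirrorRowFace, mirrorRowFace_farW] at e'
    exact e'
  exact hfree _ hmem hne hk2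

/-- ★★★★ The companion file's hypothesis `hN₂` («every wound over-walk is `w₂`-marked off the far cell») in the `K_N2`
geometry — DISCHARGED STRUCTURALLY. [cite: GlazmanManolescu2019, §1 (the paragraph of Fig. 2)] [cite: CourantRobbins1958, Ch. V Appendix §2 (the even–odd rule)] -/
theorem over_w2_killed_of_killNE (hh : holeFaceW w ∉ D)
    (hrow : ∀ x : ℤ, w.1 + 2 ≤ x → (x, w.2) ∉ D ∨ (x, w.2 + 1) ∉ D) (hK : killNE w ∉ D) (hPE : pocketNEE w ∉ D)
    (hr : RootedFace D (w.side .W) (farW w)) (θ : ℝ) :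
    ∀ (ω : ΩG D (w.side .W) (farW w)) (h : ω.IsB2a), ω.2.firstSideG = .N →
      ω.WE (fun _ => θ) ≠ excursionWinding θ ω.2.firstSideG (ω.z1 hr h) ω.1 → ¬ω.2.W2FreeOff (farW w) :=
  fun ω h hN hW => not_W2FreeOff_farW_of_wound_over_east hh hrow hK hPE ω hr h hN hW

end ΩG

end Literature.Probability.RandomPlanarGeometry.SAW.YangBaxter

namespace Literature.Barriers.CriticalPhenomena.PlaquetteWalk

open Literature.Probability.RandomPlanarGeometry.SAW.YangBaxter
open Real Complex

/-- ★★★★ **THE EASTERN KILL-FORCED ZERO, BOTH KILLS STRUCTURAL** (routes exchanged: `K_N2` kills the over route at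
`π/3`, `K_S1` the under route at `2π/3`). Hole, the two eastern kill cells `(w.1 + 1, w.2 ± 2)`, the two cells
`(w.1 + 2, w.2 ± 1)` absent, the root row's two lines uncrossable for `x ≥ w.1 + 2`, ONE `w₂`-free wound under-walk
and ONE `w₁`-free wound over-walk ⇒ an exact zero of the Yang–Baxter vertex functional in `(π/3, 2π/3)` — the
parent file's theorem with its two directness / «not north, not south» hypotheses REMOVED (instance in the venture
lane's data: the asymmetric `6×5 ∖ {(3,2),(5,0),(5,4),(0,0)}`, zero in `[0.37208π, 0.37225π]`, up to the two free
witnesses). [cite: GlazmanManolescu2019, Lemma 2.1 (statement, "in the form given in [Gl]")]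
[cite: GlazmanManolescu2019, §1 (the paragraph of Fig. 2 and the remark after eq. (1))]
[cite: Glazman2015WeightedSAW, Lemma 3.1 (proof, pp. 6–7)] [cite: DuminilCopinSmirnov2012, proof of Lemma 1]
[cite: CourantRobbins1958, Ch. V Appendix §2 (The Jordan Curve Theorem for Polygons: the even–odd rule)] -/
theorem vertexFunctional_printed_farCellW_exists_eq_zero_Ioo_of_east_kills (Dl : List Face) (w : Face)
    (hf : farW w ∈ Dl) (hh : holeFaceW w ∉ dom Dl) (hr : RootedFace (dom Dl) (w.side .W) (farW w))
    (hKN : killNE w ∉ dom Dl) (hPN : pocketNEE w ∉ dom Dl)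
    (hrowN : ∀ x : ℤ, w.1 + 2 ≤ x → (x, w.2) ∉ dom Dl ∨ (x, w.2 + 1) ∉ dom Dl)
    (hKS : killSE w ∉ dom Dl) (hPS : pocketSEE w ∉ dom Dl)
    (hrowS : ∀ x : ℤ, w.1 + 2 ≤ x → (x, w.2) ∉ dom Dl ∨ (x, w.2 - 1) ∉ dom Dl)
    (hS₂ : ∃ (ω : ΩG (dom Dl) (w.side .W) (farW w)) (h : ω.IsB2a), ω.2.firstSideG = .S ∧
      ω.WE (fun _ => π / 3) ≠ excursionWinding (π / 3) ω.2.firstSideG (ω.z1 hr h) ω.1 ∧ ω.2.W2FreeOff (farW w))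
    (hN₁ : ∃ (ω : ΩG (dom Dl) (w.side .W) (farW w)) (h : ω.IsB2a), ω.2.firstSideG = .N ∧
      ω.WE (fun _ => 2 * π / 3) ≠ excursionWinding (2 * π / 3) ω.2.firstSideG (ω.z1 hr h) ω.1 ∧
        ω.2.W1FreeOff (farW w)) :
    ∃ θ ∈ Set.Ioo (π / 3) (2 * π / 3),
      vertexFunctional (printedWeights θ) tFiveEighths (ybCoeff θ) Dl (w.side .W) (farW w) = 0 :=
  vertexFunctional_printed_farCellW_exists_eq_zero_Ioo_of_opposite_kills' Dl w hf hh hr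
    (ΩG.over_w2_killed_of_killNE hh hrowN hKN hPN hr (π / 3)) hS₂
    (ΩG.under_w1_killed_of_killSE hh hrowS hKS hPS hr (2 * π / 3)) hN₁

end Literature.Barriers.CriticalPhenomena.PlaquetteWalk
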